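import Literature.Combinatorics.AssociationSchemes.HomogeneousMatchingFamilies
import Literature.Combinatorics.Optimization.TracialDesigns
import HarnessLib

/-!
# Restricting a (cut, perfect matching) pair to the complement of a pinned partial matching

Cell pnp-psdrank (summit PneNP, rung F-N2, route `ChebyshevTracialDesign`, crux stmt-PneNP-19878), step **S2** of the
`r = 1` rung (planner p1 `N2-SpreadStructure.md` §SNT (2) Step 2; prover `R1-SKELETON.md` S2): after the Kupavskii–Zakharov
spread approximation of the matching side (S1, `Literature/Combinatorics/SetFamily/SpreadApproximation.lean`) every cell of the
rung is a set of pairs `(U, M)` — `U` a vertex set ("cut") of `K_n`, `M` a perfect matching of `K_n` — with `M ⊇ S` for a fixed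
partial matching `S` (the core of the piece, a perfect matching of its support `V`) and with prescribed pattern `U ∩ V = π`.
The cell is read in the REDUCED INSTANCE `K_{n''}`, `n'' = n − |V|`, through the restriction
`(U, M) ↦ (U ∖ V, M ∖ S)` relabelled by the increasing enumeration `emb : Fin n'' ↪o Fin n` of `univ ∖ V`.

This file is that bookkeeping, with no probability and no harmonic analysis:

* §1 the crossing count `crossCount U M = |{e ∈ M : e crosses U}|` (Rothvoß's `|δ(U) ∩ M|`; on the subtypes `OddSet n`,
  `PMatch n` it is the tree's `cc`, definitionally) and its SPLIT along `M = S ∪ (M ∖ S)`: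
  `crossCount U M = crossCount (U ∩ V) S + crossCount (U ∖ V) (M ∖ S)` — "`cc = cc'' + y`", `y` = the number of edges of
  `S` with exactly one endpoint in the pattern `π = U ∩ V`; invariance under injective relabelling;
* §2 the restriction of cuts `U ↦ U ∖ V` (a bijection `{U ⊆ Ω : U ∩ V = π} → 𝒫(Ω ∖ V)`, inverse `U'' ↦ U'' ∪ π`,
  `|U| = |U ∖ V| + |π|`) and of matchings `M ↦ M ∖ S` (a bijection `{M ∈ PM(Ω) : S ⊆ M} → PM(Ω ∖ V)`, inverse
  `M'' ↦ S ∪ M''`; this is `HomogeneousMatchingFamilies.link_perfectMatchings_eq` as maps);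
* §3 the SUM TRANSPORT over a cell, generic vertex type: for every `F : ℕ → ℕ → β`,
  `Σ_{U ∈ X, U ∩ V = π} Σ_{M ∈ Y, S ⊆ M} F(|U|, crossCount U M)
     = Σ_{U'' ∈ X''} Σ_{M'' ∈ Y(S)} F(|U''| + |π|, crossCount U'' M'' + crossCount π S)`
  with `X'' = {U ∖ V}` and `Y(S)` the Kupavskii–Zakharov link (`SpreadApproximation.link`); level weights
  `levelWeight n t C w U M` are such an `F` of `(|U|, cc U M)`;
* §4 the relabelled form in `K_{n''}`: pull back along `emb` (`cutPullback`, `pmPullback`), the bijection onto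
  (all subsets of `Fin n''`) × `PM_{n''}`, the sum transport `sum_cell_eq_sum_pullback`, cardinalities, the full star goes to
  all of `PM_{n''}` and the `t`-cuts with pattern `π` go to all `(t − |π|)`-subsets (so the cell probabilities
  `p_c(S, π) · |Q_c|` are reduced level-class cardinalities), and Kupavskii–Zakharov homogeneity of a piece transports to
  `(PM_{n''}, τ)`-homogeneity of its pull-back (from `HomogeneousMatchingFamilies` §6);
* §5 the same in the kernel's currency `OddSet n'' / PMatch n'' / Qset n'' t'' c''` when `|π|` is even (crossing-free
  patterns: `y = 0` forces `π` to be a union of edges of `S`);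
* §6 (appended) level classes and Rothvoß's measures of a cell: `#((X_π × Y_S) ∩ Q_c(t)) = #((X̃ × Ỹ) ∩ Q''_{c−y}(t−|π|))`,
  the cell probability numerator `#{(U,M) ∈ Q_c : U ∩ V = π, S ⊆ M} = |Q''_{c−y}(t−|π|)|`, and the factorisation
  `μ_c(X_π × Y_S) = (|Q''_{c−y}| / |Q_c|) · μ''_{c−y}(X̃ × Ỹ)` ("`μ_c(cell) = p_c(S,π) · Q''_{c−y}[R̃]`", planner p1 §SNT Step 2);
* §7 (appended) the NON-CROSSING CORE of a crossing cell: reducing by `S' = nonCrossing S π` (the core edges with both or no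
  endpoints in the pattern) instead of `S` keeps the reduced cuts ODD (`even_card_reducedPattern`: `|π ∩ verts S'|` is even and
  `π` crosses no edge of `S'`) and preserves `cc` exactly (`crossCount_eq_crossCount_pullback_nonCrossing`), leaving the
  `y = |S ∖ S'|` crossing core edges pinned in `K_{m'}` (a crossing-pinned junta cell) — so §5–§6 serve crossing cells too;
* §8 (appended) the matching side of S4 in the reduced instance: the reduced Kupavskii–Zakharov piece in `PMatch m` currency
  (`image_val_pmCellMatchings`, `isRelHomogeneous_pmCellMatchings_piece`), **(F2) for a reduced piece** `pmatch_closedSum_sq_le_piece`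
  (`HomogeneousMatchingFamilies.pmatch_closedSum_sq_le` instantiated; modulo the named fact `GlobalLevelDInequality`), and the
  Parseval / Cauchy–Schwarz bound `sq_sum_le_card_mul_sum_sq_univ` for the levels above Keevash–Lifshitz's range `k ≤ ⅛ log(1/ν̃)`.

The reduced cut side is deliberately parity-agnostic in §3–§4: a pattern met by an odd number `y` of crossing core edges
leaves an EVEN reduced cut `|U ∖ V| = t − |π|`, which is not an `OddSet`.

References: Rothvoß 2017, §2 [Rothvoss2017] (cuts `δ(U)`, perfect matchings as edge sets, the pairs `Q_ℓ`);
Kupavskii–Zakharov 2022, §2 [KupavskiiZakharov2022] (the link `ℱ(S)`, homogeneity). Everything here is elementary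
double counting [folklore]; no named fact is introduced. WHAT THIS IS NOT: not the conditional LAW statement of S2 with
its probabilities normalised (the prover divides by `|Q_c|`), not S3/S4, nothing about psd rank, no P-vs-NP content.
-/

noncomputable section

namespace Literature.Combinatorics.AssociationSchemes.CutMatchingRestriction

open Finset
open Literature.Barriers.PneNP
open Literature.Combinatorics.SetFamily
open Literature.Combinatorics.SimpleGraph.CycleSpace
open Literature.Combinatorics.AssociationSchemes.HomogeneousMatchingFamilies

/-! ## §1 Crossing counts: split along a pinned partial matching, relabelling -/

section Generic

variable {α : Type*} [DecidableEq α]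

/-- **The crossing count** `|δ(U) ∩ M|`: the number of pairs of `M` with exactly one endpoint in `U`.
On `U : OddSet n`, `M : PMatch n` this is the tree's `cc U M` (by `rfl`, see `cc_eq_crossCount`).
[cite: Rothvoss2017, §2 (PDF p. 5: `|δ(U) ∩ M|`)] -/
def crossCount (U : Finset α) (M : Finset (Sym2 α)) : ℕ := (M.filter (Crosses U)).card

/-- `crossCount U M ≤ |M|`. [cite: Rothvoss2017, §2 (PDF p. 5)] -/
theorem crossCount_le_card (U : Finset α) (M : Finset (Sym2 α)) : crossCount U M ≤ M.card :=
  card_filter_le _ _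

/-- The crossing count is additive over disjoint edge sets. [cite: Rothvoss2017, §2 (PDF p. 5)] -/
theorem crossCount_union {M₁ M₂ : Finset (Sym2 α)} (h : Disjoint M₁ M₂) (U : Finset α) :
    crossCount U (M₁ ∪ M₂) = crossCount U M₁ + crossCount U M₂ := by
  unfold crossCount
  rw [filter_union, card_union_of_disjoint (disjoint_filter_filter h)]

/-- The crossing count is monotone in the edge set. [cite: Rothvoss2017, §2 (PDF p. 5)] -/
theorem crossCount_mono {M₁ M₂ : Finset (Sym2 α)} (h : M₁ ⊆ M₂) (U : Finset α) :
    crossCount U M₁ ≤ crossCount U M₂ :=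
  card_le_card (filter_subset_filter _ h)

/-- Splitting off a sub-edge-set: `crossCount U M = crossCount U S + crossCount U (M ∖ S)` for `S ⊆ M`.
[cite: Rothvoss2017, §2 (PDF p. 5)] -/
theorem crossCount_eq_add_sdiff {S M : Finset (Sym2 α)} (hSM : S ⊆ M) (U : Finset α) :
    crossCount U M = crossCount U S + crossCount U (M \ S) := by
  rw [← crossCount_union disjoint_sdiff, union_sdiff_of_subset hSM]

/-- A pair inside `W` crosses `U` iff it crosses `U ∩ W`. [cite: Rothvoss2017, §2 (PDF p. 5: the cut `δ(U)` and `|δ(U) ∩ M|`)] -/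
theorem crosses_iff_crosses_inter {U W : Finset α} {e : Sym2 α} (he : e ∈ W.sym2) :
    Crosses U e ↔ Crosses (U ∩ W) e := by
  induction e using Sym2.ind with
  | h x y =>
    rw [mk_mem_sym2_iff] at he
    simp only [crosses_mk, mem_inter, he.1, he.2, and_true]

/-- Hence the crossing count of an edge set inside `W` only sees `U ∩ W`. [cite: Rothvoss2017, §2 (PDF p. 5: the cut `δ(U)` and `|δ(U) ∩ M|`)] -/
theorem crossCount_eq_crossCount_inter {U W : Finset α} {M : Finset (Sym2 α)} (hM : M ⊆ W.sym2) :
    crossCount U M = crossCount (U ∩ W) M := by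
  unfold crossCount
  congr 1
  exact filter_congr fun e he => crosses_iff_crosses_inter (hM he)

/-- Two vertex sets with the same trace on `W` have the same crossing count on edge sets inside `W`. [cite: Rothvoss2017, §2 (PDF p. 5: the cut `δ(U)` and `|δ(U) ∩ M|`)] -/
theorem crossCount_congr {U U' W : Finset α} {M : Finset (Sym2 α)} (hM : M ⊆ W.sym2) (h : U ∩ W = U' ∩ W) :
    crossCount U M = crossCount U' M := by
  rw [crossCount_eq_crossCount_inter hM, crossCount_eq_crossCount_inter (U := U') hM, h]

/-- **The split `cc = cc'' + y`.** Let `S` be a perfect matching of `V ⊆ Ω` contained in the perfect matching `M` of `Ω`,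
and `U ⊆ Ω`. Then the edges of `M` crossing `U` are the edges of `S` crossing the pattern `U ∩ V` together with the edges
of the reduced matching `M ∖ S` (a perfect matching of `Ω ∖ V`) crossing the reduced cut `U ∖ V`.
[cite: Rothvoss2017, §2 (PDF pp. 5–6)] -/
theorem crossCount_split {Ω V U : Finset α} {S M : Finset (Sym2 α)} (hV : V ⊆ Ω) (hS : IsPMOn V S)
    (hM : IsPMOn Ω M) (hSM : S ⊆ M) (hU : U ⊆ Ω) :
    crossCount U M = crossCount (U ∩ V) S + crossCount (U \ V) (M \ S) := by
  have hΩ : V ∪ (Ω \ V) = Ω := union_sdiff_of_subset hV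
  have hM' : IsPMOn (V ∪ (Ω \ V)) M := by rw [hΩ]; exact hM
  have hred : IsPMOn (Ω \ V) (M \ S) := hM'.sdiff disjoint_sdiff hS hSM
  rw [crossCount_eq_add_sdiff hSM, crossCount_eq_crossCount_inter hS.subset_sym2,
    crossCount_eq_crossCount_inter (U := U) hred.subset_sym2]
  congr 2
  ext x
  simp only [mem_inter, mem_sdiff]
  constructor
  · rintro ⟨hxU, -, hxV⟩
    exact ⟨hxU, hxV⟩
  · rintro ⟨hxU, hxV⟩
    exact ⟨hxU, hU hxU, hxV⟩

/-- In particular the reduced crossing count is at most the original one, and the deficit is the number `y` of core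
edges crossing the pattern. [cite: Rothvoss2017, §2 (PDF pp. 5–6)] -/
theorem crossCount_inter_le {Ω V U : Finset α} {S M : Finset (Sym2 α)} (hV : V ⊆ Ω) (hS : IsPMOn V S)
    (hM : IsPMOn Ω M) (hSM : S ⊆ M) (hU : U ⊆ Ω) :
    crossCount (U ∩ V) S ≤ crossCount U M := by
  rw [crossCount_split hV hS hM hSM hU]
  exact Nat.le_add_right _ _

/-- **Relabelling invariance**: along an injective map of vertex types, crossing counts are preserved. [cite: Rothvoss2017, §2 (PDF p. 5: the cut `δ(U)` and `|δ(U) ∩ M|`)] -/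
theorem crossCount_image {β : Type*} [DecidableEq β] {g : β → α} (hg : Function.Injective g) (U : Finset β)
    (M : Finset (Sym2 β)) : crossCount (U.image g) (M.image (Sym2.map g)) = crossCount U M := by
  unfold crossCount
  have hfilter : (M.image (Sym2.map g)).filter (Crosses (U.image g)) = (M.filter (Crosses U)).image (Sym2.map g) := by
    ext e
    simp only [mem_filter, mem_image]
    constructor
    · rintro ⟨⟨e₀, he₀, rfl⟩, hc⟩
      refine ⟨e₀, ⟨he₀, ?_⟩, rfl⟩
      induction e₀ using Sym2.ind with
      | h x y =>
        rw [Sym2.map_mk, crosses_mk, hg.mem_finset_image, hg.mem_finset_image] at hc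
        exact (crosses_mk U x y).2 hc
    · rintro ⟨e₀, ⟨he₀, hc⟩, rfl⟩
      refine ⟨⟨e₀, he₀, rfl⟩, ?_⟩
      induction e₀ using Sym2.ind with
      | h x y =>
        rw [Sym2.map_mk, crosses_mk, hg.mem_finset_image, hg.mem_finset_image]
        exact (crosses_mk U x y).1 hc
  rw [hfilter, card_image_of_injective _ (Sym2.map.injective hg)]

/-! ## §2 Restriction of cuts and of matchings -/

/-- `|U ∖ V| + |π| = |U|` when `U ∩ V = π`. [folklore] -/
private theorem card_sdiff_add_card_of_inter_eq {U V π : Finset α} (h : U ∩ V = π) : (U \ V).card + π.card = U.card := by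
  rw [← h, card_sdiff_add_card_inter]

/-- `(U ∖ V) ∪ π = U` when `U ∩ V = π`. [folklore] -/
private theorem sdiff_union_of_inter_eq {U V π : Finset α} (h : U ∩ V = π) : (U \ V) ∪ π = U := by
  rw [← h, sdiff_union_inter]

/-- `U ↦ U ∖ V` is injective on the cuts with a fixed pattern `U ∩ V = π`. [folklore] -/
private theorem sdiff_injOn_of_inter_eq {V π : Finset α} {U₁ U₂ : Finset α} (h₁ : U₁ ∩ V = π) (h₂ : U₂ ∩ V = π)
    (h : U₁ \ V = U₂ \ V) : U₁ = U₂ := by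
  rw [← sdiff_union_of_inter_eq h₁, ← sdiff_union_of_inter_eq h₂, h]

/-- The inverse map `U'' ↦ U'' ∪ π`: for `U''` disjoint from `V` and `π ⊆ V`, `(U'' ∪ π) ∩ V = π`. [folklore] -/
private theorem union_inter_eq_of_disjoint {U'' V π : Finset α} (hU : Disjoint U'' V) (hπ : π ⊆ V) : (U'' ∪ π) ∩ V = π := by
  rw [union_inter_distrib_right, disjoint_iff_inter_eq_empty.1 hU, empty_union, inter_eq_left.2 hπ]

/-- … and `(U'' ∪ π) ∖ V = U''`. [folklore] -/
private theorem union_sdiff_eq_of_disjoint {U'' V π : Finset α} (hU : Disjoint U'' V) (hπ : π ⊆ V) : (U'' ∪ π) \ V = U'' := by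
  rw [union_sdiff_distrib, sdiff_eq_self_of_disjoint hU, sdiff_eq_empty_iff_subset.2 hπ, union_empty]

/-- … and `|U'' ∪ π| = |U''| + |π|`. [folklore] -/
private theorem card_union_of_disjoint_of_subset {U'' V π : Finset α} (hU : Disjoint U'' V) (hπ : π ⊆ V) :
    (U'' ∪ π).card = U''.card + π.card :=
  card_union_of_disjoint (hU.mono_right hπ)

/-- **Restriction of matchings**: for a perfect matching `S` of `V ⊆ Ω` and a perfect matching `M ⊇ S` of `Ω`, the
reduced matching `M ∖ S` is a perfect matching of `Ω ∖ V`. [cite: KupavskiiZakharov2022, §2 (p. 6, the link `𝒜(S)`)] -/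
theorem isPMOn_sdiff {Ω V : Finset α} {S M : Finset (Sym2 α)} (hV : V ⊆ Ω) (hS : IsPMOn V S) (hM : IsPMOn Ω M)
    (hSM : S ⊆ M) : IsPMOn (Ω \ V) (M \ S) := by
  have hM' : IsPMOn (V ∪ (Ω \ V)) M := by rw [union_sdiff_of_subset hV]; exact hM
  exact hM'.sdiff disjoint_sdiff hS hSM

/-- The inverse map: for a perfect matching `M''` of `Ω ∖ V`, `S ∪ M''` is a perfect matching of `Ω` containing `S`, and
`(S ∪ M'') ∖ S = M''`. [cite: KupavskiiZakharov2022, §2 (p. 6, the link `𝒜(S)`)] -/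
theorem isPMOn_union_of_sdiff {Ω V : Finset α} {S M'' : Finset (Sym2 α)} (hV : V ⊆ Ω) (hS : IsPMOn V S)
    (hM'' : IsPMOn (Ω \ V) M'') : IsPMOn Ω (S ∪ M'') ∧ S ⊆ S ∪ M'' ∧ (S ∪ M'') \ S = M'' := by
  have hd : Disjoint V (Ω \ V) := disjoint_sdiff
  refine ⟨?_, subset_union_left, ?_⟩
  · have h := hS.union hM'' hd
    rwa [union_sdiff_of_subset hV] at h
  · rw [union_sdiff_left, Finset.sdiff_eq_self_iff_disjoint]
    exact (hS.disjoint_of_disjoint hM'' hd).symm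

/-! ## §3 The sum transport over a cell (generic vertex type) -/

/-- The cuts of a family `X` with pattern `π` on `V`. [cite: Rothvoss2017, §2 (PDF p. 6)] -/
def cutsWith (X : Finset (Finset α)) (V π : Finset α) : Finset (Finset α) := X.filter fun U => U ∩ V = π

/-- Membership in `cutsWith`. [cite: Rothvoss2017, §2 (PDF p. 6)] -/
@[simp] theorem mem_cutsWith {X : Finset (Finset α)} {V π U : Finset α} : U ∈ cutsWith X V π ↔ U ∈ X ∧ U ∩ V = π :=
  mem_filter

/-- The reduced cuts `{U ∖ V : U ∈ X, U ∩ V = π}`. [cite: Rothvoss2017, §2 (PDF p. 6)] -/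
def reducedCuts (X : Finset (Finset α)) (V π : Finset α) : Finset (Finset α) := (cutsWith X V π).image fun U => U \ V

/-- Membership in `reducedCuts`. [cite: Rothvoss2017, §2 (PDF p. 6)] -/
theorem mem_reducedCuts {X : Finset (Finset α)} {V π U'' : Finset α} :
    U'' ∈ reducedCuts X V π ↔ ∃ U ∈ X, U ∩ V = π ∧ U \ V = U'' := by
  simp only [reducedCuts, mem_image, mem_cutsWith, and_assoc]

/-- `|reducedCuts X V π| = |cutsWith X V π|` (restriction is injective on a pattern class). [cite: Rothvoss2017, §2 (PDF p. 6)] -/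
theorem card_reducedCuts (X : Finset (Finset α)) (V π : Finset α) :
    (reducedCuts X V π).card = (cutsWith X V π).card :=
  card_image_of_injOn fun _ h₁ _ h₂ h =>
    sdiff_injOn_of_inter_eq (mem_cutsWith.1 (mem_coe.1 h₁)).2 (mem_cutsWith.1 (mem_coe.1 h₂)).2 h

/-- Members of `reducedCuts` avoid `V`. [cite: Rothvoss2017, §2 (PDF p. 6)] -/
theorem disjoint_of_mem_reducedCuts {X : Finset (Finset α)} {V π U'' : Finset α} (h : U'' ∈ reducedCuts X V π) :
    Disjoint U'' V := by
  obtain ⟨U, -, -, rfl⟩ := mem_reducedCuts.1 h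
  exact disjoint_sdiff_self_left

/-- **Sum transport, generic form.** For a perfect matching `S` of `V ⊆ Ω`, a pattern `π ⊆ V`, a family `X` of subsets
of `Ω` and a family `Y` of perfect matchings of `Ω`, and any weight `F(|U|, crossCount U M)`:
the cell sum over `{U ∈ X : U ∩ V = π} × {M ∈ Y : S ⊆ M}` equals the sum over the reduced cuts × the link `Y(S)` of
`F(|U''| + |π|, crossCount U'' M'' + crossCount π S)`. [cite: Rothvoss2017, §2 (PDF p. 6)]
[cite: KupavskiiZakharov2022, §2 (p. 6, the link)] -/
theorem sum_cell_eq_sum_reduced {β : Type*} [AddCommMonoid β] {Ω V π : Finset α} {S : Finset (Sym2 α)}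
    (hV : V ⊆ Ω) (hS : IsPMOn V S) {X : Finset (Finset α)} (hX : ∀ U ∈ X, U ⊆ Ω)
    {Y : Finset (Finset (Sym2 α))} (hY : Y ⊆ perfectMatchings Ω) (F : ℕ → ℕ → β) :
    ∑ U ∈ cutsWith X V π, ∑ M ∈ supersets Y S, F U.card (crossCount U M) =
      ∑ U'' ∈ reducedCuts X V π, ∑ M'' ∈ link Y S,
        F (U''.card + π.card) (crossCount U'' M'' + crossCount π S) := by
  rw [reducedCuts, sum_image fun U₁ h₁ U₂ h₂ h =>
    sdiff_injOn_of_inter_eq (mem_cutsWith.1 h₁).2 (mem_cutsWith.1 h₂).2 h]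
  refine sum_congr rfl fun U hU => ?_
  obtain ⟨hUX, hUV⟩ := mem_cutsWith.1 hU
  rw [link, sum_image fun M₁ h₁ M₂ h₂ h => ?_]
  · refine sum_congr rfl fun M hM => ?_
    obtain ⟨hMY, hSM⟩ := mem_supersets.1 hM
    have hMpm : IsPMOn Ω M := mem_perfectMatchings.1 (hY hMY)
    rw [card_sdiff_add_card_of_inter_eq hUV, crossCount_split hV hS hMpm hSM (hX U hUX), hUV, add_comm]
  · have hS₁ := (mem_supersets.1 h₁).2
    have hS₂ := (mem_supersets.1 h₂).2
    rw [← union_sdiff_of_subset hS₁, ← union_sdiff_of_subset hS₂, h]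

end Generic

/-! ## §4 The reduced instance `K_{n''}`: pulling back along the enumeration of `univ ∖ V` -/

section FinRelabel

variable {n m : ℕ}

/-- **The relabelling** `emb : Fin m ↪o Fin n`, the increasing enumeration of the `m = n − |V|` vertices outside `V`.
[cite: KupavskiiZakharov2022, §2 (p. 6: the link `ℱ(S)` on the ground set minus `S`; renaming the ground set)] -/
def emb (V : Finset (Fin n)) (h : (univ \ V).card = m) : Fin m ↪o Fin n := (univ \ V).orderEmbOfFin h

/-- `emb i ∉ V`. [cite: KupavskiiZakharov2022, §2 (p. 6: the link `ℱ(S)` on the ground set minus `S`; renaming the ground set)] -/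
theorem emb_not_mem (V : Finset (Fin n)) (h : (univ \ V).card = m) (i : Fin m) : emb V h i ∉ V := by
  have := Finset.orderEmbOfFin_mem (univ \ V) h i
  exact (mem_sdiff.1 this).2

/-- `emb` is injective. [cite: KupavskiiZakharov2022, §2 (p. 6: the link `ℱ(S)` on the ground set minus `S`; renaming the ground set)] -/
theorem emb_injective (V : Finset (Fin n)) (h : (univ \ V).card = m) : Function.Injective (emb V h) :=
  (emb V h).injective

/-- Every vertex outside `V` is in the range of `emb`. [cite: KupavskiiZakharov2022, §2 (p. 6: the link `ℱ(S)` on the ground set minus `S`; renaming the ground set)] -/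
theorem exists_emb_eq (V : Finset (Fin n)) (h : (univ \ V).card = m) {x : Fin n} (hx : x ∉ V) :
    ∃ i, emb V h i = x := by
  have hx' : x ∈ Set.range (emb V h) := by
    rw [emb, Finset.range_orderEmbOfFin]
    exact mem_coe.2 (mem_sdiff.2 ⟨mem_univ _, hx⟩)
  exact hx'

/-- The image of `emb` is `univ ∖ V`. [cite: KupavskiiZakharov2022, §2 (p. 6: the link `ℱ(S)` on the ground set minus `S`; renaming the ground set)] -/
theorem image_emb_univ (V : Finset (Fin n)) (h : (univ \ V).card = m) :
    (univ : Finset (Fin m)).image (emb V h) = univ \ V := by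
  ext x
  simp only [mem_image, mem_univ, true_and, mem_sdiff]
  constructor
  · rintro ⟨i, rfl⟩
    exact emb_not_mem V h i
  · intro hx
    exact exists_emb_eq V h hx

/-- A pair in the image of `Sym2.map emb` avoids `V`. [cite: KupavskiiZakharov2022, §2 (p. 6: the link `ℱ(S)` on the ground set minus `S`; renaming the ground set)] -/
theorem map_emb_mem_sym2 (V : Finset (Fin n)) (h : (univ \ V).card = m) (e : Sym2 (Fin m)) :
    Sym2.map (emb V h) e ∈ (univ \ V).sym2 := by
  rw [mem_sym2_iff]
  intro x hx
  obtain ⟨i, -, rfl⟩ := Sym2.mem_map.1 hx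
  exact mem_sdiff.2 ⟨mem_univ _, emb_not_mem V h i⟩

/-- A pair avoiding `V` is in the image of `Sym2.map emb`. [cite: KupavskiiZakharov2022, §2 (p. 6: the link `ℱ(S)` on the ground set minus `S`; renaming the ground set)] -/
theorem exists_map_emb_eq (V : Finset (Fin n)) (h : (univ \ V).card = m) {e : Sym2 (Fin n)}
    (he : e ∈ (univ \ V).sym2) : ∃ e', Sym2.map (emb V h) e' = e := by
  induction e using Sym2.ind with
  | h x y =>
    rw [mk_mem_sym2_iff, mem_sdiff, mem_sdiff] at he
    obtain ⟨i, hi⟩ := exists_emb_eq V h he.1.2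
    obtain ⟨j, hj⟩ := exists_emb_eq V h he.2.2
    exact ⟨s(i, j), by rw [Sym2.map_mk, hi, hj]⟩

/-- **Pull-back of a cut**: `Ũ = emb⁻¹(U)`, the reduced cut `U ∖ V` read in `Fin m`.
[cite: Rothvoss2017, §2 (PDF p. 6)] -/
def cutPullback (V : Finset (Fin n)) (h : (univ \ V).card = m) (U : Finset (Fin n)) : Finset (Fin m) :=
  univ.filter fun i => emb V h i ∈ U

/-- Membership in `cutPullback`. [cite: Rothvoss2017, §2 (PDF p. 6)] -/
@[simp] theorem mem_cutPullback {V : Finset (Fin n)} {h : (univ \ V).card = m} {U : Finset (Fin n)} {i : Fin m} :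
    i ∈ cutPullback V h U ↔ emb V h i ∈ U := by
  simp [cutPullback]

/-- `emb(Ũ) = U ∖ V`. [cite: Rothvoss2017, §2 (PDF p. 6)] -/
theorem image_cutPullback (V : Finset (Fin n)) (h : (univ \ V).card = m) (U : Finset (Fin n)) :
    (cutPullback V h U).image (emb V h) = U \ V := by
  ext x
  simp only [mem_image, mem_cutPullback, mem_sdiff]
  constructor
  · rintro ⟨i, hi, rfl⟩
    exact ⟨hi, emb_not_mem V h i⟩
  · rintro ⟨hxU, hxV⟩
    obtain ⟨i, rfl⟩ := exists_emb_eq V h hxV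
    exact ⟨i, hxU, rfl⟩

/-- `|Ũ| = |U ∖ V|`. [cite: Rothvoss2017, §2 (PDF p. 6)] -/
theorem card_cutPullback (V : Finset (Fin n)) (h : (univ \ V).card = m) (U : Finset (Fin n)) :
    (cutPullback V h U).card = (U \ V).card := by
  rw [← image_cutPullback V h U, card_image_of_injective _ (emb_injective V h)]

/-- `|Ũ| + |π| = |U|` on the pattern class `U ∩ V = π`. [cite: Rothvoss2017, §2 (PDF p. 6)] -/
theorem card_cutPullback_add {V π : Finset (Fin n)} (h : (univ \ V).card = m) {U : Finset (Fin n)}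
    (hU : U ∩ V = π) : (cutPullback V h U).card + π.card = U.card := by
  rw [card_cutPullback, card_sdiff_add_card_of_inter_eq hU]

/-- `emb(Ũ)` is disjoint from `V`. [folklore] -/
private theorem disjoint_image_emb (V : Finset (Fin n)) (h : (univ \ V).card = m) (Ut : Finset (Fin m)) :
    Disjoint (Ut.image (emb V h)) V :=
  disjoint_left.2 fun x hx hxV => by
    obtain ⟨i, -, rfl⟩ := mem_image.1 hx
    exact emb_not_mem V h i hxV

/-- The inverse map on cuts: `emb⁻¹(emb(Ũ) ∪ π) = Ũ` for `π ⊆ V`. [cite: Rothvoss2017, §2 (PDF p. 6)] -/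
theorem cutPullback_image_union {V π : Finset (Fin n)} (h : (univ \ V).card = m) (hπ : π ⊆ V)
    (Ut : Finset (Fin m)) : cutPullback V h (Ut.image (emb V h) ∪ π) = Ut := by
  ext i
  rw [mem_cutPullback, mem_union, (emb_injective V h).mem_finset_image]
  constructor
  · rintro (hi | hi)
    · exact hi
    · exact absurd (hπ hi) (emb_not_mem V h i)
  · exact Or.inl

/-- `emb(Ũ) ∪ π` has pattern `π` (for `π ⊆ V`) … [cite: Rothvoss2017, §2 (PDF p. 6)] -/
theorem image_union_inter {V π : Finset (Fin n)} (h : (univ \ V).card = m) (hπ : π ⊆ V) (Ut : Finset (Fin m)) :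
    (Ut.image (emb V h) ∪ π) ∩ V = π :=
  union_inter_eq_of_disjoint (disjoint_image_emb V h Ut) hπ

/-- … and `|emb(Ũ) ∪ π| = |Ũ| + |π|`. [cite: Rothvoss2017, §2 (PDF p. 6)] -/
theorem card_image_union {V π : Finset (Fin n)} (h : (univ \ V).card = m) (hπ : π ⊆ V) (Ut : Finset (Fin m)) :
    (Ut.image (emb V h) ∪ π).card = Ut.card + π.card := by
  rw [card_union_of_disjoint_of_subset (disjoint_image_emb V h Ut) hπ,
    card_image_of_injective _ (emb_injective V h)]

/-- `cutPullback` is injective on a pattern class. [cite: Rothvoss2017, §2 (PDF p. 6)] -/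
theorem cutPullback_injOn {V π : Finset (Fin n)} (h : (univ \ V).card = m) {U₁ U₂ : Finset (Fin n)}
    (h₁ : U₁ ∩ V = π) (h₂ : U₂ ∩ V = π) (heq : cutPullback V h U₁ = cutPullback V h U₂) : U₁ = U₂ := by
  apply sdiff_injOn_of_inter_eq h₁ h₂
  rw [← image_cutPullback V h U₁, ← image_cutPullback V h U₂, heq]

/-- **Pull-back of a matching**: `M̃ = emb⁻¹(M)`, the reduced matching `M ∖ S` read in `Fin m` (edges of `M` meeting
`V` have no preimage). [cite: KupavskiiZakharov2022, §2 (p. 6, the link)] -/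
def pmPullback (V : Finset (Fin n)) (h : (univ \ V).card = m) (M : Finset (Sym2 (Fin n))) : Finset (Sym2 (Fin m)) :=
  univ.filter fun e => Sym2.map (emb V h) e ∈ M

/-- Membership in `pmPullback`. [cite: KupavskiiZakharov2022, §2 (p. 6, the link)] -/
@[simp] theorem mem_pmPullback {V : Finset (Fin n)} {h : (univ \ V).card = m} {M : Finset (Sym2 (Fin n))}
    {e : Sym2 (Fin m)} : e ∈ pmPullback V h M ↔ Sym2.map (emb V h) e ∈ M := by
  simp [pmPullback]

/-- `emb(M̃) = {e ∈ M : e avoids V}`. [cite: KupavskiiZakharov2022, §2 (p. 6, the link)] -/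
theorem image_pmPullback (V : Finset (Fin n)) (h : (univ \ V).card = m) (M : Finset (Sym2 (Fin n))) :
    (pmPullback V h M).image (Sym2.map (emb V h)) = M.filter fun e => e ∈ (univ \ V).sym2 := by
  ext e
  simp only [mem_image, mem_pmPullback, mem_filter]
  constructor
  · rintro ⟨e', he', rfl⟩
    exact ⟨he', map_emb_mem_sym2 V h e'⟩
  · rintro ⟨heM, he⟩
    obtain ⟨e', rfl⟩ := exists_map_emb_eq V h he
    exact ⟨e', heM, rfl⟩

/-- For an edge set avoiding `V` the pull-back loses nothing: `emb(emb⁻¹ M'') = M''`.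
[cite: KupavskiiZakharov2022, §2 (p. 6, the link)] -/
theorem image_pmPullback_of_subset (V : Finset (Fin n)) (h : (univ \ V).card = m) {M'' : Finset (Sym2 (Fin n))}
    (hM : M'' ⊆ (univ \ V).sym2) : (pmPullback V h M'').image (Sym2.map (emb V h)) = M'' := by
  rw [image_pmPullback, filter_true_of_mem fun e he => hM he]

/-- An endpoint of `Sym2.map emb e` lies outside `V`. [folklore] -/
private theorem not_mem_of_mem_map_emb (V : Finset (Fin n)) (h : (univ \ V).card = m) {e : Sym2 (Fin m)} {x : Fin n}
    (hx : x ∈ Sym2.map (emb V h) e) : x ∉ V :=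
  (mem_sdiff.1 (mem_sym2_iff.1 (map_emb_mem_sym2 V h e) x hx)).2

/-- Edges inside `V` are invisible to the pull-back: `emb⁻¹(M) = emb⁻¹(M ∖ S)` for `S ⊆ V.sym2`.
[cite: KupavskiiZakharov2022, §2 (p. 6, the link)] -/
theorem pmPullback_eq_pmPullback_sdiff (V : Finset (Fin n)) (h : (univ \ V).card = m) {S M : Finset (Sym2 (Fin n))}
    (hS : S ⊆ V.sym2) : pmPullback V h M = pmPullback V h (M \ S) := by
  ext e
  simp only [mem_pmPullback, mem_sdiff, iff_self_and]
  intro _ heS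
  induction e using Sym2.ind with
  | h i j =>
    have hi : emb V h i ∈ Sym2.map (emb V h) s(i, j) := by
      rw [Sym2.map_mk]; exact Sym2.mem_mk_left _ _
    exact not_mem_of_mem_map_emb V h hi (mem_sym2_iff.1 (hS heS) _ hi)

/-- `S ⊆ V.sym2` is disjoint from every image `emb(M̃)`. [folklore] -/
private theorem disjoint_image_map_emb (V : Finset (Fin n)) (h : (univ \ V).card = m) {S : Finset (Sym2 (Fin n))}
    (hS : S ⊆ V.sym2) (Mt : Finset (Sym2 (Fin m))) : Disjoint S (Mt.image (Sym2.map (emb V h))) := by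
  rw [disjoint_left]
  rintro e heS he
  obtain ⟨e', -, rfl⟩ := mem_image.1 he
  induction e' using Sym2.ind with
  | h i j =>
    have hi : emb V h i ∈ Sym2.map (emb V h) s(i, j) := by
      rw [Sym2.map_mk]; exact Sym2.mem_mk_left _ _
    exact not_mem_of_mem_map_emb V h hi (mem_sym2_iff.1 (hS heS) _ hi)

/-- The inverse map on matchings: `emb⁻¹(S ∪ emb(M̃)) = M̃` for `S ⊆ V.sym2`. [cite: KupavskiiZakharov2022, §2 (p. 6: the link `ℱ(S)` on the ground set minus `S`; renaming the ground set)] -/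
theorem pmPullback_union_image (V : Finset (Fin n)) (h : (univ \ V).card = m) {S : Finset (Sym2 (Fin n))}
    (hS : S ⊆ V.sym2) (Mt : Finset (Sym2 (Fin m))) :
    pmPullback V h (S ∪ Mt.image (Sym2.map (emb V h))) = Mt := by
  rw [pmPullback_eq_pmPullback_sdiff V h hS, union_sdiff_left,
    Finset.sdiff_eq_self_iff_disjoint.2 (disjoint_image_map_emb V h hS Mt).symm]
  ext e
  rw [mem_pmPullback, (Sym2.map.injective (emb_injective V h)).mem_finset_image]

/-- **The reduced matching is a perfect matching of `K_m`**, image form: for `S` a perfect matching of `V` and `M ⊇ S`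
a perfect matching of `K_n`, `emb(emb⁻¹ M) = M ∖ S`. [cite: KupavskiiZakharov2022, §2 (p. 6: `𝒜(S)` for perfect matchings)] -/
theorem image_pmPullback_eq_sdiff {V : Finset (Fin n)} (h : (univ \ V).card = m) {S M : Finset (Sym2 (Fin n))}
    (hS : IsPMOn V S) (hM : IsPMOn univ M) (hSM : S ⊆ M) :
    (pmPullback V h M).image (Sym2.map (emb V h)) = M \ S := by
  rw [pmPullback_eq_pmPullback_sdiff V h hS.subset_sym2]
  exact image_pmPullback_of_subset V h (isPMOn_sdiff (subset_univ V) hS hM hSM).subset_sym2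

/-- … and `emb⁻¹ M ∈ PM_m`. [cite: KupavskiiZakharov2022, §2 (p. 6: `𝒜(S)` for perfect matchings)] -/
theorem isPMOn_pmPullback {V : Finset (Fin n)} (h : (univ \ V).card = m) {S M : Finset (Sym2 (Fin n))}
    (hS : IsPMOn V S) (hM : IsPMOn univ M) (hSM : S ⊆ M) :
    IsPMOn (univ : Finset (Fin m)) (pmPullback V h M) := by
  have hred : M \ S ∈ perfectMatchings ((univ : Finset (Fin m)).image (emb V h)) := by
    rw [image_emb_univ, mem_perfectMatchings]
    exact isPMOn_sdiff (subset_univ V) hS hM hSM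
  rw [perfectMatchings_image _ _ (emb_injective V h).injOn] at hred
  obtain ⟨Mt, hMt, hMt'⟩ := mem_image.1 hred
  have : pmPullback V h M = Mt := by
    rw [pmPullback_eq_pmPullback_sdiff V h hS.subset_sym2, ← hMt']
    ext e
    rw [mem_pmPullback, (Sym2.map.injective (emb_injective V h)).mem_finset_image]
  rw [this]
  exact mem_perfectMatchings.1 hMt

/-- The inverse direction: for `M̃ ∈ PM_m`, `S ∪ emb(M̃)` is a perfect matching of `K_n` containing `S`.
[cite: KupavskiiZakharov2022, §2 (p. 6: `𝒜(S)` for perfect matchings)] -/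
theorem isPMOn_union_image {V : Finset (Fin n)} (h : (univ \ V).card = m) {S : Finset (Sym2 (Fin n))}
    (hS : IsPMOn V S) {Mt : Finset (Sym2 (Fin m))} (hMt : IsPMOn univ Mt) :
    IsPMOn univ (S ∪ Mt.image (Sym2.map (emb V h))) ∧ S ⊆ S ∪ Mt.image (Sym2.map (emb V h)) := by
  have hMt' : IsPMOn (univ \ V) (Mt.image (Sym2.map (emb V h))) := by
    have := hMt.image (emb V h) (emb_injective V h).injOn
    rwa [image_emb_univ] at this
  exact ⟨(isPMOn_union_of_sdiff (subset_univ V) hS hMt').1, subset_union_left⟩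

/-- `pmPullback` is injective on the star of `S`. [cite: KupavskiiZakharov2022, §2 (p. 6: the link `ℱ(S)` on the ground set minus `S`; renaming the ground set)] -/
theorem pmPullback_injOn {V : Finset (Fin n)} (h : (univ \ V).card = m) {S M₁ M₂ : Finset (Sym2 (Fin n))}
    (hS : IsPMOn V S) (hM₁ : IsPMOn univ M₁) (hM₂ : IsPMOn univ M₂) (h₁ : S ⊆ M₁) (h₂ : S ⊆ M₂)
    (heq : pmPullback V h M₁ = pmPullback V h M₂) : M₁ = M₂ := by
  rw [← union_sdiff_of_subset h₁, ← union_sdiff_of_subset h₂, ← image_pmPullback_eq_sdiff h hS hM₁ h₁,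
    ← image_pmPullback_eq_sdiff h hS hM₂ h₂, heq]

/-- **Crossing counts transport**: `crossCount Ũ M̃ = crossCount (U ∖ V) (M ∖ S)`.
[cite: Rothvoss2017, §2 (PDF pp. 5–6)] -/
theorem crossCount_pullback {V : Finset (Fin n)} (h : (univ \ V).card = m) {S M : Finset (Sym2 (Fin n))}
    (hS : IsPMOn V S) (hM : IsPMOn univ M) (hSM : S ⊆ M) (U : Finset (Fin n)) :
    crossCount (cutPullback V h U) (pmPullback V h M) = crossCount (U \ V) (M \ S) := by
  rw [← crossCount_image (emb_injective V h), image_cutPullback, image_pmPullback_eq_sdiff h hS hM hSM]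

/-- Hence `crossCount U M = crossCount Ũ M̃ + crossCount (U ∩ V) S` ("`cc = cc'' + y`").
[cite: Rothvoss2017, §2 (PDF pp. 5–6)] -/
theorem crossCount_eq_crossCount_pullback_add {V : Finset (Fin n)} (h : (univ \ V).card = m)
    {S M : Finset (Sym2 (Fin n))} (hS : IsPMOn V S) (hM : IsPMOn univ M) (hSM : S ⊆ M) (U : Finset (Fin n)) :
    crossCount U M = crossCount (cutPullback V h U) (pmPullback V h M) + crossCount (U ∩ V) S := by
  rw [crossCount_pullback h hS hM hSM, crossCount_split (subset_univ V) hS hM hSM (subset_univ U), add_comm]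

/-- The reduced cut family of a cell: pulled-back cuts of a pattern class. [cite: Rothvoss2017, §2 (PDF p. 6)] -/
def cellCuts (X : Finset (Finset (Fin n))) (V π : Finset (Fin n)) (h : (univ \ V).card = m) :
    Finset (Finset (Fin m)) :=
  (cutsWith X V π).image (cutPullback V h)

/-- The reduced matching family of a cell: pulled-back matchings of the star of `S` in `Y`.
[cite: KupavskiiZakharov2022, §2 (p. 6, the link)] -/
def cellMatchings (Y : Finset (Finset (Sym2 (Fin n)))) (V : Finset (Fin n)) (S : Finset (Sym2 (Fin n)))
    (h : (univ \ V).card = m) : Finset (Finset (Sym2 (Fin m))) :=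
  (supersets Y S).image (pmPullback V h)

/-- Membership in `cellCuts`. [cite: Rothvoss2017, §2 (PDF p. 6)] -/
theorem mem_cellCuts {X : Finset (Finset (Fin n))} {V π : Finset (Fin n)} {h : (univ \ V).card = m}
    {Ut : Finset (Fin m)} : Ut ∈ cellCuts X V π h ↔ ∃ U ∈ X, U ∩ V = π ∧ cutPullback V h U = Ut := by
  simp only [cellCuts, mem_image, mem_cutsWith, and_assoc]

/-- Membership in `cellMatchings`. [cite: KupavskiiZakharov2022, §2 (p. 6, the link)] -/
theorem mem_cellMatchings {Y : Finset (Finset (Sym2 (Fin n)))} {V : Finset (Fin n)} {S : Finset (Sym2 (Fin n))}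
    {h : (univ \ V).card = m} {Mt : Finset (Sym2 (Fin m))} :
    Mt ∈ cellMatchings Y V S h ↔ ∃ M ∈ Y, S ⊆ M ∧ pmPullback V h M = Mt := by
  simp only [cellMatchings, mem_image, mem_supersets, and_assoc]

/-- `|cellCuts| = |{U ∈ X : U ∩ V = π}|`. [cite: Rothvoss2017, §2 (PDF p. 6)] -/
theorem card_cellCuts (X : Finset (Finset (Fin n))) {V π : Finset (Fin n)} (h : (univ \ V).card = m) :
    (cellCuts X V π h).card = (cutsWith X V π).card :=
  card_image_of_injOn fun _ h₁ _ h₂ heq =>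
    cutPullback_injOn h (mem_cutsWith.1 (mem_coe.1 h₁)).2 (mem_cutsWith.1 (mem_coe.1 h₂)).2 heq

/-- `|cellMatchings| = |{M ∈ Y : S ⊆ M}|` for a family `Y` of perfect matchings. [cite: KupavskiiZakharov2022, §2 (p. 6: the link `ℱ(S)` on the ground set minus `S`; renaming the ground set)] -/
theorem card_cellMatchings {Y : Finset (Finset (Sym2 (Fin n)))} (hY : Y ⊆ perfectMatchings univ)
    {V : Finset (Fin n)} {S : Finset (Sym2 (Fin n))} (hS : IsPMOn V S) (h : (univ \ V).card = m) :
    (cellMatchings Y V S h).card = (supersets Y S).card :=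
  card_image_of_injOn fun _ h₁ _ h₂ heq =>
    pmPullback_injOn h hS (mem_perfectMatchings.1 (hY (mem_supersets.1 (mem_coe.1 h₁)).1))
      (mem_perfectMatchings.1 (hY (mem_supersets.1 (mem_coe.1 h₂)).1)) (mem_supersets.1 (mem_coe.1 h₁)).2
      (mem_supersets.1 (mem_coe.1 h₂)).2 heq

/-- The reduced matchings are perfect matchings of `K_m`. [cite: KupavskiiZakharov2022, §2 (p. 6)] -/
theorem cellMatchings_subset {Y : Finset (Finset (Sym2 (Fin n)))} (hY : Y ⊆ perfectMatchings univ)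
    {V : Finset (Fin n)} {S : Finset (Sym2 (Fin n))} (hS : IsPMOn V S) (h : (univ \ V).card = m) :
    cellMatchings Y V S h ⊆ perfectMatchings (univ : Finset (Fin m)) := by
  intro Mt hMt
  obtain ⟨M, hM, hSM, rfl⟩ := mem_cellMatchings.1 hMt
  exact mem_perfectMatchings.2 (isPMOn_pmPullback h hS (mem_perfectMatchings.1 (hY hM)) hSM)

/-- Reduced cuts of `t`-cuts with pattern `π` have `|Ũ| + |π| = t`. [cite: Rothvoss2017, §2 (PDF p. 6)] -/
theorem card_add_of_mem_cellCuts {X : Finset (Finset (Fin n))} {V π : Finset (Fin n)} {h : (univ \ V).card = m}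
    {Ut : Finset (Fin m)} (hUt : Ut ∈ cellCuts X V π h) {t : ℕ} (hX : ∀ U ∈ X, U.card = t) :
    Ut.card + π.card = t := by
  obtain ⟨U, hU, hUV, rfl⟩ := mem_cellCuts.1 hUt
  rw [card_cutPullback_add h hUV, hX U hU]

/-- **SUM TRANSPORT TO THE REDUCED INSTANCE.** For a perfect matching `S` of `V ⊆ Fin n`, a pattern `π`, a family
`X` of vertex sets and a family `Y` of perfect matchings of `K_n`, and any weight `F` of `(|U|, |δ(U) ∩ M|)`:
`Σ_{U ∈ X, U ∩ V = π} Σ_{M ∈ Y, S ⊆ M} F(|U|, crossCount U M)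
  = Σ_{Ũ} Σ_{M̃} F(|Ũ| + |π|, crossCount Ũ M̃ + crossCount π S)` over the pulled-back families in `K_m`, `m = n − |V|`.
[cite: Rothvoss2017, §2 (PDF p. 6)] [cite: KupavskiiZakharov2022, §2 (p. 6)] -/
theorem sum_cell_eq_sum_pullback {β : Type*} [AddCommMonoid β] {V π : Finset (Fin n)} {S : Finset (Sym2 (Fin n))}
    (hS : IsPMOn V S) (h : (univ \ V).card = m) (X : Finset (Finset (Fin n)))
    {Y : Finset (Finset (Sym2 (Fin n)))} (hY : Y ⊆ perfectMatchings univ) (F : ℕ → ℕ → β) :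
    ∑ U ∈ cutsWith X V π, ∑ M ∈ supersets Y S, F U.card (crossCount U M) =
      ∑ Ut ∈ cellCuts X V π h, ∑ Mt ∈ cellMatchings Y V S h,
        F (Ut.card + π.card) (crossCount Ut Mt + crossCount π S) := by
  rw [cellCuts, sum_image fun U₁ h₁ U₂ h₂ heq =>
    cutPullback_injOn h (mem_cutsWith.1 h₁).2 (mem_cutsWith.1 h₂).2 heq]
  refine sum_congr rfl fun U hU => ?_
  obtain ⟨-, hUV⟩ := mem_cutsWith.1 hU
  have hpm : ∀ M ∈ supersets Y S, IsPMOn univ M := fun M hM =>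
    mem_perfectMatchings.1 (hY (mem_supersets.1 hM).1)
  rw [cellMatchings, sum_image fun M₁ h₁ M₂ h₂ heq =>
    pmPullback_injOn h hS (hpm M₁ h₁) (hpm M₂ h₂) (mem_supersets.1 h₁).2 (mem_supersets.1 h₂).2 heq]
  refine sum_congr rfl fun M hM => ?_
  rw [card_cutPullback_add h hUV, crossCount_eq_crossCount_pullback_add h hS (hpm M hM) (mem_supersets.1 hM).2 U,
    hUV]

/-- **The whole star goes to all of `PM_m`**: pulling back `{M ∈ PM_n : S ⊆ M}` gives every perfect matching of `K_m`
exactly once. [cite: KupavskiiZakharov2022, §2 (p. 6: `𝒜(S)` for `𝒜 =` all perfect matchings)] -/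
theorem cellMatchings_perfectMatchings {V : Finset (Fin n)} {S : Finset (Sym2 (Fin n))} (hS : IsPMOn V S)
    (h : (univ \ V).card = m) :
    cellMatchings (perfectMatchings univ) V S h = perfectMatchings (univ : Finset (Fin m)) := by
  refine Subset.antisymm (cellMatchings_subset Subset.rfl hS h) fun Mt hMt => ?_
  have hMt' := mem_perfectMatchings.1 hMt
  obtain ⟨hM, hSM⟩ := isPMOn_union_image h hS hMt'
  exact mem_cellMatchings.2 ⟨_, mem_perfectMatchings.2 hM, hSM, pmPullback_union_image V h hS.subset_sym2 Mt⟩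

/-- **All `t`-cuts with pattern `π` go to all `(t − |π|)`-subsets of `Fin m`** (`π ⊆ V`, `|π| ≤ t`).
[cite: Rothvoss2017, §2 (PDF p. 6)] -/
theorem cellCuts_powersetCard {V π : Finset (Fin n)} (hπ : π ⊆ V) (h : (univ \ V).card = m) {t : ℕ}
    (ht : π.card ≤ t) : cellCuts (univ.powersetCard t) V π h = univ.powersetCard (t - π.card) := by
  ext Ut
  rw [mem_cellCuts, mem_powersetCard]
  constructor
  · rintro ⟨U, hU, hUV, rfl⟩
    refine ⟨subset_univ _, ?_⟩
    have := card_cutPullback_add h hUV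
    rw [(mem_powersetCard.1 hU).2] at this
    omega
  · rintro ⟨-, hcard⟩
    refine ⟨Ut.image (emb V h) ∪ π, mem_powersetCard.2 ⟨subset_univ _, ?_⟩, image_union_inter h hπ Ut,
      cutPullback_image_union h hπ Ut⟩
    rw [card_image_union h hπ, hcard]
    omega

/-- Hence the number of pairs of the FULL cell `{|U| = t, U ∩ V = π} × {M ∈ PM_n : S ⊆ M}` with `crossCount U M = c`
— the numerator of the cell probability `p_c(S, π)` — is the number of pairs `(Ũ, M̃)`, `|Ũ| = t − |π|`, `M̃ ∈ PM_m`,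
with `crossCount Ũ M̃ + y = c`: a reduced level class shifted by `y = crossCount π S`.
[cite: Rothvoss2017, §2 (PDF p. 6)] -/
theorem card_cell_level_eq {V π : Finset (Fin n)} {S : Finset (Sym2 (Fin n))} (hS : IsPMOn V S) (hπ : π ⊆ V)
    (h : (univ \ V).card = m) {t : ℕ} (ht : π.card ≤ t) (c : ℕ) :
    ((cutsWith (univ.powersetCard t) V π ×ˢ supersets (perfectMatchings univ) S).filter
        fun p => crossCount p.1 p.2 = c).card =
      ((univ.powersetCard (t - π.card) ×ˢ perfectMatchings (univ : Finset (Fin m))).filter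
        fun p => crossCount p.1 p.2 + crossCount π S = c).card := by
  have key := sum_cell_eq_sum_pullback (π := π) hS h (univ.powersetCard t) (Y := perfectMatchings univ)
    Subset.rfl (fun _ b => if b = c then (1 : ℕ) else 0)
  rw [cellMatchings_perfectMatchings hS h, cellCuts_powersetCard hπ h ht] at key
  rw [card_filter, card_filter, sum_product, sum_product]
  exact key

end FinRelabel

/-! ### §4b Homogeneity of the reduced matching family (Kupavskii–Zakharov pieces) -/

section Homogeneity

variable {n m : ℕ}

/-- A test set of reduced pairs is contained in `emb⁻¹ M` iff its image is contained in `M`. [cite: KupavskiiZakharov2022, §2 (p. 6: the link `ℱ(S)` on the ground set minus `S`; renaming the ground set)] -/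
theorem subset_pmPullback_iff {V : Finset (Fin n)} (h : (univ \ V).card = m) {M : Finset (Sym2 (Fin n))}
    {Tt : Finset (Sym2 (Fin m))} : Tt ⊆ pmPullback V h M ↔ Tt.image (Sym2.map (emb V h)) ⊆ M := by
  rw [image_subset_iff]
  exact forall₂_congr fun e _ => mem_pmPullback

/-- Stars commute with the pull-back: the members of the reduced family containing `T̃` are the pull-backs of the
members containing `emb(T̃)`. [cite: KupavskiiZakharov2022, §2 (p. 6: stars `𝒜(T)` and the link)] -/
theorem supersets_cellMatchings (𝒳 : Finset (Finset (Sym2 (Fin n)))) (V : Finset (Fin n)) (S : Finset (Sym2 (Fin n)))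
    (h : (univ \ V).card = m) (Tt : Finset (Sym2 (Fin m))) :
    supersets (cellMatchings 𝒳 V S h) Tt = cellMatchings (supersets 𝒳 (Tt.image (Sym2.map (emb V h)))) V S h := by
  rw [cellMatchings, cellMatchings, supersets, filter_image]
  congr 1
  ext M
  simp only [mem_filter, mem_supersets, subset_pmPullback_iff h]
  tauto

/-- **Homogeneity transports to the reduced instance.** If every member of a family `ℱ` of perfect matchings of `K_n`
contains the partial matching `S` (of `V`) and `ℱ` is `(PM_n(S), τ)`-homogeneous — e.g. a piece of the
Kupavskii–Zakharov spread approximation with core `S` — then its pull-back `{emb⁻¹ M : M ∈ ℱ}` is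
`(PM_m, τ)`-homogeneous, `m = n − |V|`. (Test a set `T̃` of reduced pairs through its image `emb(T̃)`, `|emb(T̃)| = |T̃|`;
the whole star pulls back onto `PM_m`.) [cite: KupavskiiZakharov2022, Lemma 11 (ii) (ℱ_i is (𝒜(S_i), τ)-homogeneous)] -/
theorem isRelHomogeneous_cellMatchings {τ : ℝ} {V : Finset (Fin n)} {S : Finset (Sym2 (Fin n))} (hS : IsPMOn V S)
    (h : (univ \ V).card = m) {ℱ : Finset (Finset (Sym2 (Fin n)))} (hℱ : ℱ ⊆ perfectMatchings univ)
    (hℱS : ∀ M ∈ ℱ, S ⊆ M) (hhom : IsRelHomogeneous τ (supersets (perfectMatchings univ) S) ℱ) :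
    IsRelHomogeneous τ (perfectMatchings (univ : Finset (Fin m))) (cellMatchings ℱ V S h) := by
  intro Tt
  set T : Finset (Sym2 (Fin n)) := Tt.image (Sym2.map (emb V h)) with hTdef
  have hT : T.card = Tt.card := card_image_of_injective _ (Sym2.map.injective (emb_injective V h))
  have hPM : supersets (perfectMatchings (univ : Finset (Fin n))) T ⊆ perfectMatchings univ := supersets_subset _ _
  rw [← cellMatchings_perfectMatchings hS h, supersets_cellMatchings, supersets_cellMatchings,
    card_cellMatchings ((supersets_subset _ _).trans hℱ) hS h, card_cellMatchings hPM hS h,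
    card_cellMatchings Subset.rfl hS h, card_cellMatchings hℱ hS h, ← hT, supersets_supersets,
    supersets_supersets, union_comm T S, ← supersets_supersets, ← supersets_supersets ,
    supersets_eq_self_of_forall hℱS]
  exact hhom T

/-- The core of a Kupavskii–Zakharov piece of a family of perfect matchings is a partial matching: a perfect matching of
its support `verts S`. [cite: KupavskiiZakharov2022, Lemma 11 (the cores `S_i` are subsets of members)] -/
theorem isPMOn_verts_core {ℱ : Finset (Finset (Sym2 (Fin n)))} (hℱ : ℱ ⊆ perfectMatchings univ) {τ : ℝ} {q : ℕ}
    (D : SpreadApproximation (perfectMatchings univ) ℱ τ q) (i : Fin D.k) : IsPMOn (verts (D.core i)) (D.core i) := by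
  obtain ⟨M, hM⟩ := D.piece_nonempty i
  exact isPMOn_verts (mem_perfectMatchings.1 (hℱ (D.piece_subset_family i hM))) (D.core_subset_of_mem_piece hM)

/-- **The pieces of the spread approximation, reduced**: the pull-back of the `i`-th Kupavskii–Zakharov piece of a
family `ℱ ⊆ PM_n` (core `S_i`, support `V_i = verts S_i`, `m = n − |V_i|`) is a `(PM_m, τ)`-homogeneous family of
perfect matchings of `K_m` with `|ℱ_i|` members. [cite: KupavskiiZakharov2022, Lemma 11 (ii)] -/
theorem isRelHomogeneous_cellMatchings_piece {ℱ : Finset (Finset (Sym2 (Fin n)))} (hℱ : ℱ ⊆ perfectMatchings univ)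
    {τ : ℝ} {q : ℕ} (D : SpreadApproximation (perfectMatchings univ) ℱ τ q) (i : Fin D.k)
    (h : (univ \ verts (D.core i)).card = m) :
    IsRelHomogeneous τ (perfectMatchings (univ : Finset (Fin m))) (cellMatchings (D.piece i) (verts (D.core i)) (D.core i) h) ∧
      cellMatchings (D.piece i) (verts (D.core i)) (D.core i) h ⊆ perfectMatchings univ ∧
      (cellMatchings (D.piece i) (verts (D.core i)) (D.core i) h).card = (D.piece i).card := by
  have hS := isPMOn_verts_core hℱ D i
  have hPℱ : D.piece i ⊆ perfectMatchings univ := (D.piece_subset_family i).trans hℱ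
  have hPS : ∀ M ∈ D.piece i, D.core i ⊆ M := fun M hM => D.core_subset_of_mem_piece hM
  refine ⟨isRelHomogeneous_cellMatchings hS h hPℱ hPS (D.homogeneous i), cellMatchings_subset hPℱ hS h, ?_⟩
  rw [card_cellMatchings hPℱ hS h, supersets_eq_self_of_forall hPS]

end Homogeneity

/-! ## §5 The kernel's currency: `OddSet`, `PMatch`, `Qset`, `levelWeight` -/

section Kernel

variable {n m : ℕ}

/-- Reindexing a sum over `s.subtype p` when all of `s` satisfies `p`. [folklore] -/
private theorem sum_subtype_eq {ι β : Type*} [AddCommMonoid β] (s : Finset ι) (p : ι → Prop) [DecidablePred p]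
    (h : ∀ x ∈ s, p x) (g : {x // p x} → β) (f : ι → β) (hfg : ∀ x ∈ s, ∀ hx : p x, g ⟨x, hx⟩ = f x) :
    ∑ x ∈ s.subtype p, g x = ∑ x ∈ s, f x := by
  rw [← sum_subtype_of_mem f h]
  refine sum_congr rfl fun x hx => ?_
  obtain ⟨x, hpx⟩ := x
  exact hfg x (mem_subtype.1 hx) hpx

/-- The tree's `cc` is `crossCount` on the underlying finsets (definitionally). [cite: Rothvoss2017, §2 (PDF p. 5)] -/
theorem cc_eq_crossCount (U : OddSet n) (M : PMatch n) : cc U M = crossCount U.1 M.1 := rfl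

/-- **The reduced cuts as odd sets** (for a pattern of even size the reduced cut `|U| − |π|` stays odd).
[cite: Rothvoss2017, §2 (PDF p. 6)] -/
def oddCellCuts (X : Finset (OddSet n)) (V π : Finset (Fin n)) (h : (univ \ V).card = m) : Finset (OddSet m) :=
  (cellCuts (X.image Subtype.val) V π h).subtype fun U => Odd U.card

/-- **The reduced matchings as `PMatch m`**. [cite: KupavskiiZakharov2022, §2 (p. 6, the link)] -/
def pmCellMatchings (Y : Finset (PMatch n)) (V : Finset (Fin n)) (S : Finset (Sym2 (Fin n)))
    (h : (univ \ V).card = m) : Finset (PMatch m) :=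
  (cellMatchings (Y.image Subtype.val) V S h).subtype fun M => IsPMOn (univ : Finset (Fin m)) M

/-- Every reduced cut of an odd cut with an even pattern is odd. [cite: Rothvoss2017, §2 (PDF p. 6)] -/
theorem odd_of_mem_cellCuts {X : Finset (OddSet n)} {V π : Finset (Fin n)} (hπ : Even π.card)
    {h : (univ \ V).card = m} {Ut : Finset (Fin m)} (hUt : Ut ∈ cellCuts (X.image Subtype.val) V π h) : Odd Ut.card := by
  obtain ⟨U, hU, hUV, rfl⟩ := mem_cellCuts.1 hUt
  obtain ⟨U', -, rfl⟩ := mem_image.1 hU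
  have hodd : Odd U'.1.card := U'.2
  have hc := card_cutPullback_add h hUV
  rw [← hc] at hodd
  exact (Nat.odd_add.1 hodd).2 hπ

/-- `|oddCellCuts| = |{U ∈ X : U ∩ V = π}|` for an even pattern. [cite: Rothvoss2017, §2 (PDF p. 6)] -/
theorem card_oddCellCuts (X : Finset (OddSet n)) {V π : Finset (Fin n)} (hπ : Even π.card) (h : (univ \ V).card = m) :
    (oddCellCuts X V π h).card = (X.filter fun U => U.1 ∩ V = π).card := by
  rw [oddCellCuts, card_subtype, filter_true_of_mem fun Ut hUt => odd_of_mem_cellCuts hπ hUt, card_cellCuts,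
    cutsWith, filter_image, card_image_of_injective _ Subtype.val_injective]

/-- `|pmCellMatchings| = |{M ∈ Y : S ⊆ M}|`. [cite: KupavskiiZakharov2022, §2 (p. 6: the link `ℱ(S)` on the ground set minus `S`; renaming the ground set)] -/
theorem card_pmCellMatchings (Y : Finset (PMatch n)) {V : Finset (Fin n)} {S : Finset (Sym2 (Fin n))}
    (hS : IsPMOn V S) (h : (univ \ V).card = m) :
    (pmCellMatchings Y V S h).card = (Y.filter fun M => S ⊆ M.1).card := by
  rw [pmCellMatchings, card_subtype, filter_true_of_mem fun Mt hMt =>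
      mem_perfectMatchings.1 (cellMatchings_subset (image_val_subset Y) hS h hMt),
    card_cellMatchings (image_val_subset Y) hS h, supersets, filter_image,
    card_image_of_injective _ Subtype.val_injective]

/-- The whole column set pulls back onto the whole reduced column set. [cite: KupavskiiZakharov2022, §2 (p. 6)] -/
theorem pmCellMatchings_univ {V : Finset (Fin n)} {S : Finset (Sym2 (Fin n))} (hS : IsPMOn V S)
    (h : (univ \ V).card = m) : pmCellMatchings (univ : Finset (PMatch n)) V S h = univ := by
  have himg : (univ : Finset (PMatch n)).image Subtype.val = perfectMatchings univ := by
    ext M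
    simp only [mem_image, mem_univ, true_and, mem_perfectMatchings]
    exact ⟨fun ⟨M', hM'⟩ => hM' ▸ M'.2, fun hM => ⟨⟨M, hM⟩, rfl⟩⟩
  ext Mt
  simp only [pmCellMatchings, mem_subtype, himg, cellMatchings_perfectMatchings hS h, mem_perfectMatchings, mem_univ,
    iff_true]
  exact Mt.2

/-- All `t`-cuts with an even pattern `π ⊆ V` pull back onto all `(t − |π|)`-cuts of `K_m` (`t` odd, `|π| ≤ t`).
[cite: Rothvoss2017, §2 (PDF p. 6)] -/
theorem oddCellCuts_univ_filter {V π : Finset (Fin n)} (hπ : π ⊆ V) (h : (univ \ V).card = m)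
    {t : ℕ} (ht : π.card ≤ t) (hto : Odd t) :
    oddCellCuts (univ.filter fun U : OddSet n => U.1.card = t) V π h = univ.filter fun U : OddSet m => U.1.card = t - π.card := by
  have himg : (univ.filter fun U : OddSet n => U.1.card = t).image Subtype.val = univ.powersetCard t := by
    ext U
    simp only [mem_image, mem_filter, mem_univ, true_and, mem_powersetCard, subset_univ]
    constructor
    · rintro ⟨U', hU', rfl⟩; exact hU'
    · intro hU; exact ⟨⟨U, hU ▸ hto⟩, hU, rfl⟩
  ext Ut
  simp only [oddCellCuts, mem_subtype, himg, cellCuts_powersetCard hπ h ht, mem_powersetCard, subset_univ, true_and,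
    mem_filter, mem_univ]

/-- **SUM TRANSPORT, kernel currency.** For a perfect matching `S` of `V`, an EVEN pattern `π`, families `X` of odd cuts
and `Y` of perfect matchings of `K_n`, and any weight `F(|U|, cc U M)`:
`Σ_{U ∈ X, U ∩ V = π} Σ_{M ∈ Y, S ⊆ M} F(|U|, cc U M) = Σ_{Ũ ∈ X̃} Σ_{M̃ ∈ Ỹ} F(|Ũ| + |π|, cc Ũ M̃ + y)`,
`y = crossCount π S`, over `X̃ = oddCellCuts`, `Ỹ = pmCellMatchings` in `K_m`.
[cite: Rothvoss2017, §2 (PDF p. 6)] [cite: KupavskiiZakharov2022, §2 (p. 6)] -/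
theorem sum_cell_eq_sum_pullback_subtype {β : Type*} [AddCommMonoid β] {V π : Finset (Fin n)}
    {S : Finset (Sym2 (Fin n))} (hS : IsPMOn V S) (hπe : Even π.card) (h : (univ \ V).card = m)
    (X : Finset (OddSet n)) (Y : Finset (PMatch n)) (F : ℕ → ℕ → β) :
    ∑ U ∈ X.filter (fun U => U.1 ∩ V = π), ∑ M ∈ Y.filter (fun M => S ⊆ M.1), F U.1.card (cc U M) =
      ∑ Ut ∈ oddCellCuts X V π h, ∑ Mt ∈ pmCellMatchings Y V S h,
        F (Ut.1.card + π.card) (cc Ut Mt + crossCount π S) := by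
  have hY := image_val_subset Y
  -- pass to the underlying finsets
  have hL : ∑ U ∈ X.filter (fun U => U.1 ∩ V = π), ∑ M ∈ Y.filter (fun M => S ⊆ M.1), F U.1.card (cc U M) =
      ∑ U ∈ cutsWith (X.image Subtype.val) V π, ∑ M ∈ supersets (Y.image Subtype.val) S, F U.card (crossCount U M) := by
    rw [cutsWith, filter_image, sum_image fun _ _ _ _ hxy => Subtype.val_injective hxy]
    refine sum_congr rfl fun U _ => ?_
    rw [supersets, filter_image, sum_image fun _ _ _ _ hxy => Subtype.val_injective hxy]
    rfl
  rw [hL, sum_cell_eq_sum_pullback hS h _ hY F]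
  symm
  refine sum_subtype_eq _ _ (fun Ut hUt => odd_of_mem_cellCuts hπe hUt) _ _ fun Ut _ _ => ?_
  exact sum_subtype_eq _ _ (fun Mt hMt => mem_perfectMatchings.1 (cellMatchings_subset hY hS h hMt)) _ _
    fun Mt _ _ => rfl

/-- The level weight of a multilevel planted weight is a function of `(|U|, cc U M)` alone:
`levelFn n t C w a b = Σ_{c ∈ C} w_c · 1[a = t ∧ b = c] / |Q_c(t)|`. [cite: Rothvoss2017, §2 (PDF p. 6, eq. (2))] -/
def levelFn (n t : ℕ) (C : Finset ℕ) (w : ℕ → ℝ) (a b : ℕ) : ℝ :=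
  ∑ c ∈ C, if a = t ∧ b = c then w c / ((Qset n t c).card : ℝ) else 0

/-- `levelWeight n t C w U M = levelFn n t C w |U| (cc U M)`. [cite: Rothvoss2017, §2 (PDF p. 6, eq. (2))] -/
theorem levelWeight_eq_levelFn (t : ℕ) (C : Finset ℕ) (w : ℕ → ℝ) (U : OddSet n) (M : PMatch n) :
    Literature.Combinatorics.Optimization.levelWeight n t C w U M = levelFn n t C w U.1.card (cc U M) := by
  unfold Literature.Combinatorics.Optimization.levelWeight levelFn
  refine sum_congr rfl fun c _ => ?_
  simp only [mem_Qset_iff]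

/-- **The design value of a cell, reduced.** For an exact design's planted weight `W = levelWeight n t C w`, a perfect
matching `S` of `V`, an even pattern `π` and families `X`, `Y`:
`Σ_{U ∈ X, U ∩ V = π} Σ_{M ∈ Y, S ⊆ M} W(U, M) = Σ_{c ∈ C} (w_c / |Q_c(t)|) · #{(Ũ, M̃) ∈ X̃ × Ỹ : |Ũ| + |π| = t, cc Ũ M̃ + y = c}`.
(The prover normalises by `|Q''|` to read the count as `p_c · Q''_{c−y}[X̃ × Ỹ]`.) [cite: Rothvoss2017, §2 (PDF p. 6, eq. (2))] -/
theorem sum_cell_levelWeight_eq {V π : Finset (Fin n)} {S : Finset (Sym2 (Fin n))} (hS : IsPMOn V S)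
    (hπe : Even π.card) (h : (univ \ V).card = m) (t : ℕ) (C : Finset ℕ) (w : ℕ → ℝ) (X : Finset (OddSet n))
    (Y : Finset (PMatch n)) :
    ∑ U ∈ X.filter (fun U => U.1 ∩ V = π), ∑ M ∈ Y.filter (fun M => S ⊆ M.1),
        Literature.Combinatorics.Optimization.levelWeight n t C w U M =
      ∑ c ∈ C, w c / ((Qset n t c).card : ℝ) *
        (((oddCellCuts X V π h ×ˢ pmCellMatchings Y V S h).filter fun p =>
          p.1.1.card + π.card = t ∧ cc p.1 p.2 + crossCount π S = c).card : ℝ) := by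
  simp only [levelWeight_eq_levelFn]
  rw [sum_cell_eq_sum_pullback_subtype hS hπe h X Y (levelFn n t C w)]
  simp only [levelFn]
  refine (sum_congr rfl fun Ut _ => sum_comm).trans ?_
  rw [sum_comm]
  refine sum_congr rfl fun c _ => ?_
  rw [card_filter, sum_product, Nat.cast_sum, mul_sum]
  refine sum_congr rfl fun Ut _ => ?_
  rw [Nat.cast_sum, mul_sum]
  refine sum_congr rfl fun Mt _ => ?_
  split_ifs <;> simp

/-- The shifted reduced level class is a genuine level class `Q''_{c−y}(t − |π|)` once `y ≤ c` and `|π| ≤ t`.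
[cite: Rothvoss2017, §2 (PDF p. 6)] -/
theorem filter_shift_eq_inter_Qset (X' : Finset (OddSet m)) (Y' : Finset (PMatch m)) {t c y p : ℕ} (hy : y ≤ c)
    (hp : p ≤ t) :
    ((X' ×ˢ Y').filter fun q => q.1.1.card + p = t ∧ cc q.1 q.2 + y = c) = (X' ×ˢ Y') ∩ Qset m (t - p) (c - y) := by
  ext q
  simp only [mem_filter, mem_inter, mem_Qset_iff, and_congr_right_iff]
  intro _
  omega

/-- … and it is empty when `c < y` or `t < |π|` (a cell whose core already crosses the pattern `y` times carries no
pair of level `c < y`). [cite: Rothvoss2017, §2 (PDF p. 6)] -/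
theorem filter_shift_eq_empty (X' : Finset (OddSet m)) (Y' : Finset (PMatch m)) {t c y p : ℕ} (h : c < y ∨ t < p) :
    ((X' ×ˢ Y').filter fun q => q.1.1.card + p = t ∧ cc q.1 q.2 + y = c) = ∅ := by
  refine filter_eq_empty_iff.2 fun q _ hq => ?_
  omega

end Kernel

/-! ## §6 Level classes and Rothvoß's measures `μ_c` of a cell: `μ_c(cell ∩ R) = p_c(S, π) · μ''_{c−y}(R̃)` -/

section Measures

variable {n m : ℕ}

/-- **Level classes of a cell are shifted reduced level classes**: for an even pattern `π` (`|π| ≤ t`) and `y ≤ c`,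
`#((X_π × Y_S) ∩ Q_c(t)) = #((X̃ × Ỹ) ∩ Q''_{c−y}(t − |π|))` in `K_m`. [cite: Rothvoss2017, §2 (PDF p. 6: `Q_ℓ`, `μ_ℓ`)] -/
theorem card_cell_inter_Qset_eq {V π : Finset (Fin n)} {S : Finset (Sym2 (Fin n))} (hS : IsPMOn V S) (hπe : Even π.card)
    (h : (univ \ V).card = m) (X : Finset (OddSet n)) (Y : Finset (PMatch n)) {t c : ℕ} (hy : crossCount π S ≤ c)
    (hp : π.card ≤ t) :
    (((X.filter fun U => U.1 ∩ V = π) ×ˢ (Y.filter fun M => S ⊆ M.1)) ∩ Qset n t c).card =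
      ((oddCellCuts X V π h ×ˢ pmCellMatchings Y V S h) ∩ Qset m (t - π.card) (c - crossCount π S)).card := by
  have key := sum_cell_eq_sum_pullback_subtype hS hπe h X Y (fun a b => if a = t ∧ b = c then (1 : ℕ) else 0)
  rw [← filter_shift_eq_inter_Qset _ _ hy hp, ← filter_mem_eq_inter, card_filter, card_filter, sum_product, sum_product]
  simp only [mem_Qset_iff] at key ⊢
  exact key

/-- Below the shift the cell has no pairs: `#((X_π × Y_S) ∩ Q_c(t)) = 0` for `c < y` or `t < |π|`.
[cite: Rothvoss2017, §2 (PDF p. 6: `Q_ℓ`, `μ_ℓ`)] -/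
theorem card_cell_inter_Qset_eq_zero {V π : Finset (Fin n)} {S : Finset (Sym2 (Fin n))} (hS : IsPMOn V S)
    (hπe : Even π.card) (h : (univ \ V).card = m) (X : Finset (OddSet n)) (Y : Finset (PMatch n)) {t c : ℕ}
    (hlt : c < crossCount π S ∨ t < π.card) :
    (((X.filter fun U => U.1 ∩ V = π) ×ˢ (Y.filter fun M => S ⊆ M.1)) ∩ Qset n t c).card = 0 := by
  have key := sum_cell_eq_sum_pullback_subtype hS hπe h X Y (fun a b => if a = t ∧ b = c then (1 : ℕ) else 0)
  rw [← filter_mem_eq_inter, card_filter, sum_product]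
  simp only [mem_Qset_iff] at key ⊢
  rw [key]
  refine sum_eq_zero fun Ut _ => sum_eq_zero fun Mt _ => ?_
  rw [if_neg]
  omega

/-- **The cell probability is a ratio of level-class sizes**: the number of pairs `(U, M) ∈ Q_c(t)` with `U ∩ V = π` and
`S ⊆ M` is `|Q''_{c−y}(t − |π|)|`, the size of a level class of `K_m` (`π` even, `|π| ≤ t`, `y ≤ c`, `t` odd).
[cite: Rothvoss2017, §2 (PDF p. 6: `Q_ℓ`)] -/
theorem card_univ_cell_inter_Qset_eq {V π : Finset (Fin n)} {S : Finset (Sym2 (Fin n))} (hS : IsPMOn V S) (hπ : π ⊆ V)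
    (hπe : Even π.card) (h : (univ \ V).card = m) {t c : ℕ} (hto : Odd t) (hy : crossCount π S ≤ c) (hp : π.card ≤ t) :
    ((((univ : Finset (OddSet n)).filter fun U => U.1 ∩ V = π) ×ˢ
        ((univ : Finset (PMatch n)).filter fun M => S ⊆ M.1)) ∩ Qset n t c).card =
      (Qset m (t - π.card) (c - crossCount π S)).card := by
  have hX : ((univ : Finset (OddSet n)).filter fun U => U.1 ∩ V = π) =
      (univ.filter fun U : OddSet n => U.1.card = t).filter (fun U => U.1 ∩ V = π) ∪
        (univ.filter fun U : OddSet n => U.1.card ≠ t).filter (fun U => U.1 ∩ V = π) := by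
    rw [← filter_union, filter_union_filter_not_eq]
  have hdisj : Disjoint ((univ.filter fun U : OddSet n => U.1.card = t).filter (fun U => U.1 ∩ V = π))
      ((univ.filter fun U : OddSet n => U.1.card ≠ t).filter (fun U => U.1 ∩ V = π)) :=
    disjoint_filter_filter (disjoint_filter_filter_not _ _ _)
  -- the cuts of the wrong size contribute nothing to `Q_c(t)`
  have hzero : ((((univ.filter fun U : OddSet n => U.1.card ≠ t).filter fun U => U.1 ∩ V = π) ×ˢ
      ((univ : Finset (PMatch n)).filter fun M => S ⊆ M.1)) ∩ Qset n t c).card = 0 := by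
    rw [card_eq_zero, ← filter_mem_eq_inter, filter_eq_empty_iff]
    rintro ⟨U, M⟩ hq hQ
    rw [mem_product, mem_filter, mem_filter] at hq
    exact hq.1.1.2 (mem_Qset_iff.1 hQ).1
  rw [hX, union_product, union_inter_distrib_right, card_union_of_disjoint
      (disjoint_of_subset_left inter_subset_left (disjoint_of_subset_right inter_subset_left
        (disjoint_product.2 (Or.inl hdisj)))), hzero, add_zero,
    card_cell_inter_Qset_eq hS hπe h _ _ hy hp, oddCellCuts_univ_filter hπ h hp hto, pmCellMatchings_univ hS h,
    ← filter_mem_eq_inter]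
  congr 1
  ext q
  simp only [mem_filter, mem_product, mem_univ, and_true, mem_Qset_iff]
  tauto

/-- **Rothvoß's measure of a cell factorises**: `μ_c((X_π × Y_S)) = (|Q''_{c−y}(t−|π|)| / |Q_c(t)|) · μ''_{c−y}(X̃ × Ỹ)` — the first
factor is the cell probability `p_c(S, π) = P_{Q_c}[U ∩ V = π, S ⊆ M]` (`card_univ_cell_inter_Qset_eq`), the second the reduced
instance's measure of the reduced rectangle (`π` even, `|π| ≤ t`, `y ≤ c`; if the reduced class is empty both sides vanish).
[cite: Rothvoss2017, §2 (PDF p. 6: `μ_ℓ(X × Y) = |(X × Y) ∩ Q_ℓ| / |Q_ℓ|`)] -/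
theorem mu_cell_eq {V π : Finset (Fin n)} {S : Finset (Sym2 (Fin n))} (hS : IsPMOn V S) (hπe : Even π.card)
    (h : (univ \ V).card = m) (X : Finset (OddSet n)) (Y : Finset (PMatch n)) {t c : ℕ} (hy : crossCount π S ≤ c)
    (hp : π.card ≤ t) :
    mu n t c (X.filter fun U => U.1 ∩ V = π) (Y.filter fun M => S ⊆ M.1) =
      ((Qset m (t - π.card) (c - crossCount π S)).card / (Qset n t c).card : ℝ) *
        mu m (t - π.card) (c - crossCount π S) (oddCellCuts X V π h) (pmCellMatchings Y V S h) := by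
  unfold mu
  rw [card_cell_inter_Qset_eq hS hπe h X Y hy hp]
  rcases Nat.eq_zero_or_pos (Qset m (t - π.card) (c - crossCount π S)).card with h0 | hpos
  · have hsub : ((oddCellCuts X V π h ×ˢ pmCellMatchings Y V S h) ∩ Qset m (t - π.card) (c - crossCount π S)).card = 0 :=
      Nat.eq_zero_of_le_zero (h0 ▸ card_le_card inter_subset_right)
    rw [hsub, h0]
    simp
  · have hne : ((Qset m (t - π.card) (c - crossCount π S)).card : ℝ) ≠ 0 := by positivity
    field_simp

/-- Below the shift the cell measure vanishes (`c < y` or `t < |π|`). [cite: Rothvoss2017, §2 (PDF p. 6)] -/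
theorem mu_cell_eq_zero {V π : Finset (Fin n)} {S : Finset (Sym2 (Fin n))} (hS : IsPMOn V S) (hπe : Even π.card)
    (h : (univ \ V).card = m) (X : Finset (OddSet n)) (Y : Finset (PMatch n)) {t c : ℕ}
    (hlt : c < crossCount π S ∨ t < π.card) :
    mu n t c (X.filter fun U => U.1 ∩ V = π) (Y.filter fun M => S ⊆ M.1) = 0 := by
  unfold mu
  rw [card_cell_inter_Qset_eq_zero hS hπe h X Y hlt, Nat.cast_zero, zero_div]

end Measures

/-! ## §7 The non-crossing core of a crossing cell (reduce by `S' ⊆ S`, keep odd cuts) -/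

section NonCrossing

variable {α : Type*} [DecidableEq α]

/-- **The non-crossing part of a core** with respect to a pattern `π`: the edges of `S` with both or no endpoints in
`π` (the crossing edges `S ∖ nonCrossing S π` are the `y = crossCount π S` edges that stay PINNED in the reduced instance).
[cite: Rothvoss2017, §2 (PDF pp. 5–6: `δ(U) ∩ M`)] -/
def nonCrossing (S : Finset (Sym2 α)) (π : Finset α) : Finset (Sym2 α) := S.filter fun e => ¬Crosses π e

/-- `nonCrossing S π ⊆ S`. [cite: Rothvoss2017, §2 (PDF pp. 5–6)] -/
theorem nonCrossing_subset (S : Finset (Sym2 α)) (π : Finset α) : nonCrossing S π ⊆ S := filter_subset _ _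

/-- Membership in `nonCrossing`. [cite: Rothvoss2017, §2 (PDF pp. 5–6)] -/
@[simp] theorem mem_nonCrossing {S : Finset (Sym2 α)} {π : Finset α} {e : Sym2 α} :
    e ∈ nonCrossing S π ↔ e ∈ S ∧ ¬Crosses π e := mem_filter

/-- The pattern crosses no edge of the non-crossing part. [cite: Rothvoss2017, §2 (PDF pp. 5–6)] -/
theorem crossCount_nonCrossing (S : Finset (Sym2 α)) (π : Finset α) : crossCount π (nonCrossing S π) = 0 := by
  rw [crossCount, card_eq_zero, filter_eq_empty_iff]
  exact fun e he => (mem_nonCrossing.1 he).2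

/-- The removed edges are exactly the crossing ones: `|S ∖ nonCrossing S π| = crossCount π S` (`= y`).
[cite: Rothvoss2017, §2 (PDF pp. 5–6)] -/
theorem card_sdiff_nonCrossing (S : Finset (Sym2 α)) (π : Finset α) :
    (S \ nonCrossing S π).card = crossCount π S := by
  rw [crossCount, nonCrossing, sdiff_eq_filter]
  congr 1
  refine filter_congr fun e he => ?_
  simp only [mem_filter, he, true_and, not_not]

/-- `S = nonCrossing S π ∪ (crossing edges)`, disjointly. [cite: Rothvoss2017, §2 (PDF pp. 5–6)] -/
theorem nonCrossing_union_filter (S : Finset (Sym2 α)) (π : Finset α) :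
    nonCrossing S π ∪ S.filter (Crosses π) = S := by
  rw [nonCrossing, union_comm, filter_union_filter_not_eq]

/-- A pair has exactly one endpoint in `U` iff it crosses `U`. [cite: Rothvoss2017, §2 (PDF p. 5: `δ(U)`)] -/
theorem cutCount_eq_one_iff {U : Finset α} {e : Sym2 α} : cutCount U e = 1 ↔ Crosses U e := by
  induction e using Sym2.ind with
  | h a b =>
    rw [cutCount_mk, crosses_mk]
    by_cases ha : a ∈ U <;> by_cases hb : b ∈ U <;> simp [ha, hb]

/-- The trace of the pattern on an edge set it does not cross only sees whole edges: for a perfect matching `S'` of `V'`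
not crossed by `π`, `|π ∩ V'|` is even. [cite: Rothvoss2017, §2 (PDF p. 6: "for parity reasons")] -/
theorem even_card_inter_of_crossCount_eq_zero {V' π : Finset α} {S' : Finset (Sym2 α)} (hS : IsPMOn V' S')
    (h0 : crossCount π S' = 0) : Even (π ∩ V').card := by
  have h1 := hS.card_eq_sum_cutCount (inter_subset_right (s₁ := π))
  rw [sum_cutCount_eq] at h1
  have hz : (S'.filter fun e => cutCount (π ∩ V') e = 1).card = 0 := by
    rw [← h0, crossCount_eq_crossCount_inter hS.subset_sym2, crossCount]
    exact congrArg card (filter_congr fun e _ => cutCount_eq_one_iff)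
  rw [hz, zero_add] at h1
  exact ⟨_, h1.trans (two_mul _)⟩

end NonCrossing

section NonCrossingFin

variable {n : ℕ}

/-- In `K_n`: the non-crossing part of a core `S ⊆ M` (`M` a perfect matching) is a perfect matching of its support
`verts (nonCrossing S π)`. [cite: Rothvoss2017, §2 (PDF p. 6: perfect matchings as edge sets)] -/
theorem isPMOn_verts_nonCrossing {S M : Finset (Sym2 (Fin n))} (hM : IsPMOn univ M) (hSM : S ⊆ M) (π : Finset (Fin n)) :
    IsPMOn (verts (nonCrossing S π)) (nonCrossing S π) :=
  isPMOn_verts hM ((nonCrossing_subset S π).trans hSM)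

/-- **The reduced pattern of a crossing cell is even**: with `S' = nonCrossing S π` and `V' = verts S'`, the pattern
`π' = π ∩ V'` has even size and crosses no edge of `S'` — so the kernel-currency transport (§5, §6: odd reduced cuts,
`cc` preserved exactly) applies to the reduction by `S'`, leaving the `y = crossCount π S` crossing core edges pinned and
crossed once each in `K_{m'}` (a crossing-pinned junta cell). [cite: Rothvoss2017, §2 (PDF p. 6)] -/
theorem even_card_reducedPattern {S M : Finset (Sym2 (Fin n))} (hM : IsPMOn univ M) (hSM : S ⊆ M) (π : Finset (Fin n)) :
    Even (π ∩ verts (nonCrossing S π)).card ∧ crossCount (π ∩ verts (nonCrossing S π)) (nonCrossing S π) = 0 := by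
  have hS' := isPMOn_verts_nonCrossing hM hSM π
  have h0 : crossCount (π ∩ verts (nonCrossing S π)) (nonCrossing S π) = 0 := by
    rw [← crossCount_eq_crossCount_inter hS'.subset_sym2]
    exact crossCount_nonCrossing S π
  exact ⟨even_card_inter_of_crossCount_eq_zero hS' (crossCount_nonCrossing S π), h0⟩

/-- The crossing count is unchanged by the reduction along the non-crossing part:
`cc(U, M) = cc(Ũ, M̃)` with `(Ũ, M̃)` the pull-back along `emb (verts S')`. [cite: Rothvoss2017, §2 (PDF pp. 5–6)] -/
theorem crossCount_eq_crossCount_pullback_nonCrossing {m : ℕ} {S M : Finset (Sym2 (Fin n))} (hM : IsPMOn univ M)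
    (hSM : S ⊆ M) (π : Finset (Fin n)) (h : (univ \ verts (nonCrossing S π)).card = m) {U : Finset (Fin n)}
    (hU : U ∩ verts (nonCrossing S π) = π ∩ verts (nonCrossing S π)) :
    crossCount U M =
      crossCount (cutPullback (verts (nonCrossing S π)) h U) (pmPullback (verts (nonCrossing S π)) h M) := by
  rw [crossCount_eq_crossCount_pullback_add h (isPMOn_verts_nonCrossing hM hSM π) hM
    ((nonCrossing_subset S π).trans hSM) U, hU, (even_card_reducedPattern hM hSM π).2, add_zero]

end NonCrossingFin

/-! ## §8 The matching side of S4 in the reduced instance: (F2) for a reduced Kupavskii–Zakharov piece, and the Parseval bound -/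

section ReducedPiece

open Literature.Combinatorics.Additive.KeevashLifshitz (GlobalLevelDInequality)
open Literature.Combinatorics.AssociationSchemes.JohnsonHarmonics (IsHarmonic)

variable {n m : ℕ}

/-- The underlying edge sets of the reduced `PMatch` family are the reduced edge-set family. [cite: KupavskiiZakharov2022, §2 (p. 6, the link)] -/
theorem image_val_pmCellMatchings (Y : Finset (PMatch n)) {V : Finset (Fin n)} {S : Finset (Sym2 (Fin n))} (hS : IsPMOn V S)
    (h : (univ \ V).card = m) :
    (pmCellMatchings Y V S h).image Subtype.val = cellMatchings (Y.image Subtype.val) V S h := by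
  ext Mt
  simp only [mem_image, pmCellMatchings, mem_subtype]
  constructor
  · rintro ⟨M', hM', rfl⟩
    exact hM'
  · intro hMt
    exact ⟨⟨Mt, mem_perfectMatchings.1 (cellMatchings_subset (image_val_subset Y) hS h hMt)⟩, hMt, rfl⟩

/-- Selecting the members of `Y` whose edge sets lie in a subfamily `P ⊆ Y` (e.g. a Kupavskii–Zakharov piece of the edge-set family of
`Y`) and forgetting the subtype gives back `P`. [cite: KupavskiiZakharov2022, Lemma 11 (the pieces ℱ_i ⊆ ℱ)] -/
theorem image_val_filter_mem_eq (Y : Finset (PMatch n)) {P : Finset (Finset (Sym2 (Fin n)))} (hP : P ⊆ Y.image Subtype.val) :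
    (Y.filter fun M => M.1 ∈ P).image Subtype.val = P := by
  ext M
  simp only [mem_image, mem_filter]
  constructor
  · rintro ⟨M', ⟨-, hM'⟩, rfl⟩
    exact hM'
  · intro hM
    obtain ⟨M', hM'Y, rfl⟩ := mem_image.1 (hP hM)
    exact ⟨M', ⟨hM'Y, hM⟩, rfl⟩

/-- **The reduced piece in `PMatch` currency is `(PM_m, τ)`-homogeneous and has `|ℱ_i|` members**: for the spread approximation `D` of
the edge-set family of `Y : Finset (PMatch n)` and its `i`-th piece (core `S_i`, `V_i = verts S_i`, `m = n − |V_i|`), the family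
`Ỹ_i = pmCellMatchings (Y.filter (·.1 ∈ ℱ_i)) V_i S_i h : Finset (PMatch m)` satisfies the hypothesis of
`HomogeneousMatchingFamilies.pmatch_closedSum_sq_le` in `K_m`. [cite: KupavskiiZakharov2022, Lemma 11 (ii)] -/
theorem isRelHomogeneous_pmCellMatchings_piece (Y : Finset (PMatch n)) {τ : ℝ} {q : ℕ}
    (D : SpreadApproximation (perfectMatchings univ) (Y.image Subtype.val) τ q) (i : Fin D.k) (h : (univ \ verts (D.core i)).card = m) :
    IsRelHomogeneous τ (perfectMatchings (univ : Finset (Fin m)))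
        ((pmCellMatchings (Y.filter fun M => M.1 ∈ D.piece i) (verts (D.core i)) (D.core i) h).image Subtype.val) ∧
      (pmCellMatchings (Y.filter fun M => M.1 ∈ D.piece i) (verts (D.core i)) (D.core i) h).card = (D.piece i).card := by
  have hS := isPMOn_verts_core (image_val_subset Y) D i
  have hP : D.piece i ⊆ Y.image Subtype.val := D.piece_subset_family i
  obtain ⟨hhom, -, hcard⟩ := isRelHomogeneous_cellMatchings_piece (image_val_subset Y) D i h
  rw [image_val_pmCellMatchings _ hS h, image_val_filter_mem_eq Y hP]
  refine ⟨hhom, ?_⟩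
  calc (pmCellMatchings (Y.filter fun M => M.1 ∈ D.piece i) (verts (D.core i)) (D.core i) h).card
      = ((pmCellMatchings (Y.filter fun M => M.1 ∈ D.piece i) (verts (D.core i)) (D.core i) h).image Subtype.val).card :=
        (card_image_of_injective _ Subtype.val_injective).symm
    _ = (D.piece i).card := by rw [image_val_pmCellMatchings _ hS h, image_val_filter_mem_eq Y hP, hcard]

/-- **(F2) for a reduced Kupavskii–Zakharov piece** (modulo the named fact `GlobalLevelDInequality`, Keevash–Lifshitz Thm 1.8): with `Ỹ_i` as in
`isRelHomogeneous_pmCellMatchings_piece`, `ν̃ = |Ỹ_i| / |PM_m|`, `p` harmonic of degree `k`, `1 ≤ k ≤ min(⅛ log(1/ν̃), 10⁻⁵ m)`, `τ ≥ 1`: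
`(Σ_{M̃ ∈ Ỹ_i} Π_p(M̃))² ≤ ν̃² (C τ² k⁻¹ log(1/ν̃))^k · |PM_m| · Σ_{M̃} Π_p(M̃)²`, the functional written as in the kernel's bi-mode expansion. For the
levels `k > ⅛ log(1/ν̃)` use `sq_sum_le_card_mul_sum_sq_univ` (Parseval) instead. [cite: KeevashLifshitz2023, Thm 1.8] [cite: KupavskiiZakharov2022, Lemma 11 (ii)] -/
theorem pmatch_closedSum_sq_le_piece (hKL : GlobalLevelDInequality) :
    ∃ C : ℝ, 0 < C ∧ ∀ (n : ℕ) (Y : Finset (PMatch n)) (τ : ℝ) (q : ℕ)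
      (D : SpreadApproximation (perfectMatchings univ) (Y.image Subtype.val) τ q) (i : Fin D.k) (m : ℕ)
      (h : (univ \ verts (D.core i)).card = m) (k : ℕ) (p : Finset (Fin m) → ℝ), 1 ≤ τ → 1 ≤ k → IsHarmonic k p →
      (k : ℝ) ≤ Real.log (1 / (((pmCellMatchings (Y.filter fun M => M.1 ∈ D.piece i) (verts (D.core i)) (D.core i) h).card : ℝ) /
        Fintype.card (PMatch m))) / 8 →
      (k : ℝ) ≤ (m : ℝ) / 10 ^ 5 →
      (∑ M ∈ pmCellMatchings (Y.filter fun M => M.1 ∈ D.piece i) (verts (D.core i)) (D.core i) h,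
          ∑ T ∈ univ.filter (fun T : Finset (Fin m) => (T.filter fun x => M.2.partner x ∈ T).card = k), p T) ^ 2 ≤
        (((pmCellMatchings (Y.filter fun M => M.1 ∈ D.piece i) (verts (D.core i)) (D.core i) h).card : ℝ) /
            Fintype.card (PMatch m)) ^ 2 *
          (C * τ ^ 2 * (1 / (k : ℝ)) * Real.log (1 / (((pmCellMatchings (Y.filter fun M => M.1 ∈ D.piece i)
            (verts (D.core i)) (D.core i) h).card : ℝ) / Fintype.card (PMatch m)))) ^ k *
          ((Fintype.card (PMatch m) : ℝ) *
            ∑ M : PMatch m,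
              (∑ T ∈ univ.filter (fun T : Finset (Fin m) => (T.filter fun x => M.2.partner x ∈ T).card = k), p T) ^ 2) := by
  obtain ⟨C, hC, hmain⟩ := pmatch_closedSum_sq_le hKL
  refine ⟨C, hC, fun n Y τ q D i m h k p hτ hk hp h8 hm => ?_⟩
  exact hmain m _ τ k p hτ (isRelHomogeneous_pmCellMatchings_piece Y D i h).1 hk hp h8 hm

/-- **Parseval / Cauchy–Schwarz for the dense range** (assembler note (N-a); no named fact): for any family `Y'` and any functional `f`,
`(Σ_{M ∈ Y'} f M)² ≤ |Y'| · Σ_{all M} f(M)²`, i.e. the level-`k` weight of `1_{Y'}` is at most its density. [cite: ODonnell2014, §1.4 (Parseval)] -/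
theorem sq_sum_le_card_mul_sum_sq_univ {ι : Type*} [Fintype ι] [DecidableEq ι] (Y' : Finset ι) (f : ι → ℝ) :
    (∑ M ∈ Y', f M) ^ 2 ≤ (Y'.card : ℝ) * ∑ M, f M ^ 2 := by
  calc (∑ M ∈ Y', f M) ^ 2 = (∑ M ∈ Y', 1 * f M) ^ 2 := by simp
    _ ≤ (∑ M ∈ Y', (1 : ℝ) ^ 2) * ∑ M ∈ Y', f M ^ 2 := sum_mul_sq_le_sq_mul_sq Y' (fun _ => 1) f
    _ ≤ (Y'.card : ℝ) * ∑ M, f M ^ 2 := by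
        rw [one_pow, sum_const, nsmul_eq_mul, mul_one]
        exact mul_le_mul_of_nonneg_left (sum_le_univ_sum_of_nonneg fun M => sq_nonneg (f M)) (Nat.cast_nonneg _)

/-- The same in the normalised form used next to (F2): `(Σ_{M ∈ Y'} f M)² ≤ ν' · (|PM_m| · Σ_M f(M)²)`, `ν' = |Y'|/|PM_m|`.
[cite: ODonnell2014, §1.4 (Parseval)] -/
theorem sq_sum_le_density_mul (Y' : Finset (PMatch m)) (f : PMatch m → ℝ) (hm : 0 < Fintype.card (PMatch m)) :
    (∑ M ∈ Y', f M) ^ 2 ≤ ((Y'.card : ℝ) / Fintype.card (PMatch m)) * ((Fintype.card (PMatch m) : ℝ) * ∑ M, f M ^ 2) := by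
  have hpos : (0 : ℝ) < Fintype.card (PMatch m) := by exact_mod_cast hm
  have key : ((Y'.card : ℝ) / Fintype.card (PMatch m)) * ((Fintype.card (PMatch m) : ℝ) * ∑ M, f M ^ 2) =
      (Y'.card : ℝ) * ∑ M, f M ^ 2 := by
    field_simp
  rw [key]
  exact sq_sum_le_card_mul_sum_sq_univ Y' f

end ReducedPiece

end Literature.Combinatorics.AssociationSchemes.CutMatchingRestriction
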